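import Literature.Analysis.FluidPDE.HessianLaplacian
import Mathlib.Analysis.Calculus.BumpFunction.FiniteDimension
import Mathlib.Analysis.Normed.Module.Ball.Pointwise
import HarnessLib

/-!
# Interior `L²` estimates for classical solutions of second-order equations close to the
# Laplacian (Caccioppoli and Hessian energies with a cut-off)

Analysis/PDE support file on the discharge path of the named fact
`Literature.Geometry.Lorentzian.exists_conformal_negativeMass_of_massZero` (Schoen–Yau,
Comm. Math. Phys. 65 (1979), Cor. 3.1 via Lemma 3.2): the asymptotic analysis of the solution
`v` of `Δv - fv = h` on an asymptotically flat end ((3.5)–(3.20), pp. 65–71: *"standard linear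
elliptic estimates (see [17, p. 161] for the interior estimate)"*, [17] = Gilbarg–Trudinger)
needs scaled interior estimates for the derivatives of a classical solution on balls
`B_σ(x) ⊂ {r > R}`, `σ = |x|/2`, of an operator whose coefficients differ from those of the flat
Laplacian by `O(r⁻²)`. For **smooth** solutions these estimates are elementary, and this file
proves them in that form, in a finite-dimensional real inner product space `E` with an
orthonormal basis `b` (`∂ᵢ = D(·)(bᵢ)`, `Δ` = Mathlib's Laplacian):

* hypothesis: a pointwise *Laplacian inequality* on a compact set `S`,
  `|Δu| ≤ ε √(Σᵢⱼ(∂ⱼ∂ᵢu)²) + L √(Σᵢ(∂ᵢu)²) + L² |u| + G` with `0 ≤ ε ≤ 1/10`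
  (what an equation `aᵢⱼ∂ᵢⱼu + bᵢ∂ᵢu + cu = g` with `Σ|aᵢⱼ - δᵢⱼ| ≤ ε`, `|b| ≤ L`, `|c| ≤ L²`
  gives, and what its differentiated forms give for the derivatives of `u`);
* `cutoff_energy_estimates` — for `u, η ∈ C³`, `η` supported in `S`, `|η| ≤ 1`, `|∂η| ≤ L`,
  `|∂²η| ≤ L²`:
  `∫ η² Σᵢ(∂ᵢu)² ≤ 400(n+1)² L² ∫_S u² + 3 L⁻² ∫_S G²`,
  `∫ η⁴ Σᵢⱼ(∂ⱼ∂ᵢu)² ≤ 220000(n+1)³ L⁴ ∫_S u² + 1800(n+1) ∫_S G²`,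
  `∫ (Δ(η²u))² ≤ 46000(n+1)³ L⁴ ∫_S u² + 400(n+1) ∫_S G²` (`n = dim E`);
* `ball_energy_estimates` — the same on concentric balls `B(x₀,σ/2) ⊂ B̄(x₀,σ)` for
  `u ∈ C³(U)`, `U ⊇ B̄(x₀,σ)` open, with `L = M/σ` for a dimensional constant `M ≥ 1`
  (cut-offs at scale `σ`, `exists_cutoff_scale`; globalisation `exists_contDiff_eqOn_ball`),
  including a `C³_c` cut-off product `w = u` on `B̄(x₀,σ/2)` with `∫ (Δw)²` controlled — the
  input of the pointwise bound `w(x)² ≲ σ ∫ (Δw)²` in dimension three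
  (`Analysis/PDE/InteriorSupBound.lean`).

Proof (Gilbarg–Trudinger, proofs of Thm. 8.8 and Thm. 9.11, run for `C³` functions where no
difference quotients are needed): Green's first identity tested with `η²u` (Caccioppoli,
`integral_cutoff_sq_mul_sum_sq_fderiv_le`), the Hessian–Laplacian identity
`Σᵢⱼ ∫ (∂ⱼ∂ᵢw)² = ∫ (Δw)²` for `w = η²u ∈ C³_c` (tree:
`integral_sum_sq_fderiv_fderiv_eq_integral_laplacian_sq`, `FluidPDE/HessianLaplacian.lean`),
pointwise Leibniz bounds for `∂²(η²u)` and `Δ(η²u)`, the squared Laplacian inequality, and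
Young's inequality to absorb the `ε`-term (`energy_bookkeeping`). Everything is proved; no
definitions and no named facts are introduced.

## References

* D. Gilbarg, N. S. Trudinger, *Elliptic partial differential equations of second order*,
  Springer (2001 reprint), Thm. 8.8 (interior `H²` regularity), Thm. 9.11 (interior `W^{2,p}`
  estimate), §9.4 (the case `p = 2` by integration by parts). [GilbargTrudinger2001]
* R. Schoen, S.-T. Yau, *On the proof of the positive mass conjecture in general relativity*,
  Comm. Math. Phys. 65 (1979) 45–76, proof of Lemma 3.2, (3.5)–(3.9) and (3.19)–(3.20).
  [SchoenYauPMT1979]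
-/

noncomputable section

-- nested operator types `E →L[ℝ] E →L[ℝ] ℝ`
set_option maxSynthPendingDepth 3

open MeasureTheory Set Function Filter InnerProductSpace Metric
open scoped RealInnerProductSpace Laplacian ContDiff Topology

namespace Literature.Analysis.PDE

open Literature.Analysis.FluidPDE

variable {E : Type*} [NormedAddCommGroup E] [InnerProductSpace ℝ E]

/-! ### Elementary real inequalities -/

section RealAux

/-- `(a - b - c - d)² ≤ 4 (a² + b² + c² + d²)`. [folklore] -/
theorem sq_sub_sub_sub_le (a b c d : ℝ) :
    (a - b - c - d) ^ 2 ≤ 4 * (a ^ 2 + b ^ 2 + c ^ 2 + d ^ 2) := by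
  nlinarith [sq_nonneg (a + b), sq_nonneg (a + c), sq_nonneg (a + d), sq_nonneg (b - c),
    sq_nonneg (b - d), sq_nonneg (c - d)]

/-- Young: `2 a b ≤ κ a² + b² / κ` for `κ > 0`. [folklore] -/
theorem two_mul_le_add_sq_div {κ : ℝ} (hκ : 0 < κ) (a b : ℝ) :
    2 * a * b ≤ κ * a ^ 2 + b ^ 2 / κ := by
  have h : 0 ≤ (κ * a - b) ^ 2 / κ := div_nonneg (sq_nonneg _) hκ.le
  have : (κ * a - b) ^ 2 / κ = κ * a ^ 2 + b ^ 2 / κ - 2 * a * b := by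
    field_simp
    ring
  linarith

/-- Cauchy–Schwarz for finite sums in the form `(∑ aᵢ bᵢ)² ≤ (∑ aᵢ²)(∑ bᵢ²)`. [folklore] -/
theorem sq_sum_mul_le {ι : Type*} (s : Finset ι) (a b : ι → ℝ) :
    (∑ i ∈ s, a i * b i) ^ 2 ≤ (∑ i ∈ s, a i ^ 2) * ∑ i ∈ s, b i ^ 2 :=
  Finset.sum_mul_sq_le_sq_mul_sq s a b

/-- A sum of `card` terms each bounded by `M` in absolute value has square at most
`card² M²`. [folklore] -/
theorem sq_sum_le_card_sq_mul {ι : Type*} [Fintype ι] {a : ι → ℝ} {M : ℝ}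
    (h : ∀ i, |a i| ≤ M) : (∑ i, a i) ^ 2 ≤ (Fintype.card ι : ℝ) ^ 2 * M ^ 2 := by
  have hM : ∀ i, 0 ≤ M := fun i => (abs_nonneg _).trans (h i)
  have hs : |∑ i, a i| ≤ Fintype.card ι * M := by
    refine (Finset.abs_sum_le_sum_abs _ _).trans ?_
    calc ∑ i, |a i| ≤ ∑ _i : ι, M := Finset.sum_le_sum fun i _ => h i
      _ = Fintype.card ι * M := by rw [Finset.sum_const, nsmul_eq_mul, Finset.card_univ]
  have h0 : 0 ≤ (Fintype.card ι : ℝ) * M := by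
    rcases isEmpty_or_nonempty ι with hι | ⟨⟨i⟩⟩
    · simp
    · exact mul_nonneg (Nat.cast_nonneg _) (hM i)
  calc (∑ i, a i) ^ 2 = |∑ i, a i| ^ 2 := (sq_abs _).symm
    _ ≤ (Fintype.card ι * M) ^ 2 := pow_le_pow_left₀ (abs_nonneg _) hs 2
    _ = (Fintype.card ι : ℝ) ^ 2 * M ^ 2 := by ring

/-- The bookkeeping of the interior `L²` estimates: elimination of the Hessian, Laplacian and
Caccioppoli inequalities into bounds for the first and second weighted derivative energies.
[folklore] -/
theorem energy_bookkeeping {n ε L P0 P1 P2 Γ W A T : ℝ} (hn : 0 ≤ n) (hε0 : 0 ≤ ε)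
    (hε : ε ≤ 1 / 10) (hL : 0 < L) (hP0 : 0 ≤ P0) (hP1 : 0 ≤ P1) (hP2 : 0 ≤ P2) (hΓ : 0 ≤ Γ)
    (h3 : P2 ≤ 4 * W + 32 * n * L ^ 2 * P1 + 64 * n ^ 2 * L ^ 4 * P0)
    (h4 : W ≤ 3 * A + 48 * n * L ^ 2 * P1 + 48 * n ^ 2 * L ^ 4 * P0)
    (h5 : A ≤ 4 * ε ^ 2 * P2 + 4 * L ^ 2 * P1 + 4 * L ^ 4 * P0 + 4 * Γ)
    (hC : P1 ≤ T + 4 * n * L ^ 2 * P0)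
    (hT : T ≤ (ε * (4 * (96 + 448 * n)) + 7) * L ^ 2 * P0
      + ε / (4 * (96 + 448 * n) * L ^ 2) * P2 + P1 / 4 + Γ / L ^ 2) :
    P1 ≤ 400 * (n + 1) ^ 2 * L ^ 2 * P0 + 3 * Γ / L ^ 2 ∧
      P2 ≤ 220000 * (n + 1) ^ 3 * L ^ 4 * P0 + 1800 * (n + 1) * Γ ∧
      W ≤ 46000 * (n + 1) ^ 3 * L ^ 4 * P0 + 400 * (n + 1) * Γ := by
  obtain ⟨α, hα⟩ : ∃ α : ℝ, α = 96 + 448 * n := ⟨_, rfl⟩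
  obtain ⟨β, hβ⟩ : ∃ β : ℝ, β = 96 + 512 * n ^ 2 := ⟨_, rfl⟩
  rw [← hα] at hT
  have hαpos : 0 < α := by rw [hα]; positivity
  have hα96 : 96 ≤ α := by rw [hα]; linarith [mul_nonneg (by norm_num : (0:ℝ) ≤ 448) hn]
  have hL2 : 0 < L ^ 2 := by positivity
  have hL4 : 0 < L ^ 4 := by positivity
  -- Step 1: the Hessian bound, linear in `P2`
  have hε2 : 48 * ε ^ 2 ≤ 1 / 2 := by nlinarith only [hε, hε0]
  have hS1 : P2 ≤ α * L ^ 2 * P1 + β * L ^ 4 * P0 + 96 * Γ := by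
    have hlin : (1 - 48 * ε ^ 2) * P2 ≤
        (48 + 224 * n) * L ^ 2 * P1 + (48 + 256 * n ^ 2) * L ^ 4 * P0 + 48 * Γ := by
      linarith only [h3, h4, h5]
    have hhalf : P2 / 2 ≤ (1 - 48 * ε ^ 2) * P2 := by
      nlinarith only [mul_nonneg (show (0:ℝ) ≤ 1 - 48 * ε ^ 2 - 1 / 2 by linarith only [hε2])
        hP2]
    rw [hα, hβ]
    linarith only [hlin, hhalf]
  -- Step 2: the `P2` term of the Caccioppoli bound
  have hq0 : 0 ≤ ε / (4 * α * L ^ 2) := by positivity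
  have hS2 : ε / (4 * α * L ^ 2) * P2 ≤
      ε / 4 * P1 + ε * β / (4 * α) * L ^ 2 * P0 + 24 * ε / α * (Γ / L ^ 2) := by
    have h := mul_le_mul_of_nonneg_left hS1 hq0
    have e : ε / (4 * α * L ^ 2) * (α * L ^ 2 * P1 + β * L ^ 4 * P0 + 96 * Γ) =
        ε / 4 * P1 + ε * β / (4 * α) * L ^ 2 * P0 + 24 * ε / α * (Γ / L ^ 2) := by
      field_simp
      ring
    linarith only [h, e]
  -- Step 3: numerical bounds on the coefficients
  have hc1 : ε * β / (4 * α) ≤ 1 + n ^ 2 := by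
    rw [div_le_iff₀ (by positivity)]
    have hβ0 : 0 ≤ β := by rw [hβ]; positivity
    have h1 : ε * β ≤ (1 / 10) * β := mul_le_mul_of_nonneg_right hε hβ0
    have h2 : (1 / 10) * β ≤ (1 + n ^ 2) * (4 * 96) := by rw [hβ]; nlinarith only [sq_nonneg n]
    have h3 : (1 + n ^ 2) * (4 * 96) ≤ (1 + n ^ 2) * (4 * α) := by
      have : 0 ≤ 1 + n ^ 2 := by positivity
      nlinarith only [hα96, this]
    linarith only [h1, h2, h3]
  have hc2 : 24 * ε / α ≤ 1 := by
    rw [div_le_iff₀ hαpos]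
    linarith only [hε, hα96]
  have hc3 : ε * (4 * α) ≤ 39 + 180 * n := by
    rw [hα]; nlinarith only [hε, hε0, hn]
  -- Step 4: the first-order energy
  have hP1 : P1 ≤ 400 * (n + 1) ^ 2 * L ^ 2 * P0 + 3 * Γ / L ^ 2 := by
    have hΓL : 0 ≤ Γ / L ^ 2 := by positivity
    have hmain : (3 / 4 - ε / 4) * P1 ≤
        (ε * (4 * α) + 7 + 4 * n + ε * β / (4 * α)) * L ^ 2 * P0
          + (1 + 24 * ε / α) * (Γ / L ^ 2) := by
      linarith only [hS2, hC, hT]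
    have hcoef : (ε * (4 * α) + 7 + 4 * n + ε * β / (4 * α)) ≤ 47 + 184 * n + n ^ 2 := by
      linarith only [hc1, hc3]
    have hcoef2 : (1 + 24 * ε / α) ≤ 2 := by linarith only [hc2]
    have hlhs : 29 / 40 * P1 ≤ (3 / 4 - ε / 4) * P1 := by
      nlinarith only [mul_nonneg (show (0:ℝ) ≤ 3 / 4 - ε / 4 - 29 / 40 by linarith only [hε])
        hP1]
    have hrhs : (ε * (4 * α) + 7 + 4 * n + ε * β / (4 * α)) * L ^ 2 * P0
          + (1 + 24 * ε / α) * (Γ / L ^ 2) ≤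
        (47 + 184 * n + n ^ 2) * L ^ 2 * P0 + 2 * (Γ / L ^ 2) := by
      have h1 := mul_le_mul_of_nonneg_right hcoef (mul_nonneg hL2.le hP0)
      have h2 := mul_le_mul_of_nonneg_right hcoef2 hΓL
      linarith only [h1, h2]
    have h29 : 29 / 40 * P1 ≤ (47 + 184 * n + n ^ 2) * L ^ 2 * P0 + 2 * (Γ / L ^ 2) := by
      linarith only [hlhs, hmain, hrhs]
    have hfin : P1 ≤ 40 / 29 * ((47 + 184 * n + n ^ 2) * L ^ 2 * P0 + 2 * (Γ / L ^ 2)) := by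
      linarith only [h29]
    have hpoly : 40 / 29 * (47 + 184 * n + n ^ 2) ≤ 400 * (n + 1) ^ 2 := by
      nlinarith only [hn, sq_nonneg n]
    have h3 := mul_le_mul_of_nonneg_right hpoly (mul_nonneg hL2.le hP0)
    rw [mul_div_assoc]
    linarith only [hfin, h3, hΓL]
  -- Step 5: the second-order energy
  have hαb : α ≤ 544 * (n + 1) := by rw [hα]; linarith only [hn]
  have hβb : β ≤ 608 * (n + 1) ^ 2 := by rw [hβ]; nlinarith only [hn]
  have hn1 : 1 ≤ n + 1 := by linarith
  have hP2b : P2 ≤ 220000 * (n + 1) ^ 3 * L ^ 4 * P0 + 1800 * (n + 1) * Γ := by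
    calc P2 ≤ α * L ^ 2 * P1 + β * L ^ 4 * P0 + 96 * Γ := hS1
      _ ≤ 544 * (n + 1) * L ^ 2 * (400 * (n + 1) ^ 2 * L ^ 2 * P0 + 3 * Γ / L ^ 2)
            + 608 * (n + 1) ^ 2 * L ^ 4 * P0 + 96 * Γ := by
          gcongr
      _ = (217600 * (n + 1) ^ 3 + 608 * (n + 1) ^ 2) * L ^ 4 * P0
            + (1632 * (n + 1) + 96) * Γ := by
          field_simp
          ring
      _ ≤ 220000 * (n + 1) ^ 3 * L ^ 4 * P0 + 1800 * (n + 1) * Γ := by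
          have h1 : (217600 * (n + 1) ^ 3 + 608 * (n + 1) ^ 2) ≤ 220000 * (n + 1) ^ 3 := by
            nlinarith only [pow_le_pow_right₀ hn1 (show 2 ≤ 3 by norm_num)]
          have h2 : (1632 * (n + 1) + 96) ≤ 1800 * (n + 1) := by linarith only [hn]
          have h3 := mul_le_mul_of_nonneg_right h1 (mul_nonneg hL4.le hP0)
          have h4 := mul_le_mul_of_nonneg_right h2 hΓ
          linarith only [h3, h4]
  refine ⟨hP1, hP2b, ?_⟩
  -- Step 6: the Laplacian of the cut-off product
  have hW1 : W ≤ 12 * ε ^ 2 * P2 + (12 + 48 * n) * L ^ 2 * P1 + (12 + 48 * n ^ 2) * L ^ 4 * P0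
      + 12 * Γ := by linarith only [h4, h5]
  have hε2' : 12 * ε ^ 2 ≤ 12 / 100 := by nlinarith only [hε, hε0]
  have t1 : 12 * ε ^ 2 * P2 ≤ 12 / 100 * (220000 * (n + 1) ^ 3 * L ^ 4 * P0 + 1800 * (n + 1) * Γ) :=
    (mul_le_mul_of_nonneg_left hP2b (by positivity)).trans
      (mul_le_mul_of_nonneg_right hε2' (by positivity))
  have hc12 : (12 + 48 * n) * L ^ 2 ≤ 48 * (n + 1) * L ^ 2 :=
    mul_le_mul_of_nonneg_right (by linarith only [hn]) hL2.le
  have t2 : (12 + 48 * n) * L ^ 2 * P1 ≤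
      48 * (n + 1) * L ^ 2 * (400 * (n + 1) ^ 2 * L ^ 2 * P0 + 3 * Γ / L ^ 2) :=
    (mul_le_mul_of_nonneg_left hP1 (by positivity)).trans
      (mul_le_mul_of_nonneg_right hc12 (by positivity))
  have e2 : 48 * (n + 1) * L ^ 2 * (400 * (n + 1) ^ 2 * L ^ 2 * P0 + 3 * Γ / L ^ 2) =
      19200 * (n + 1) ^ 3 * L ^ 4 * P0 + 144 * (n + 1) * Γ := by
    field_simp
    ring
  have t3 : (12 + 48 * n ^ 2) * L ^ 4 * P0 ≤ 48 * (n + 1) ^ 3 * L ^ 4 * P0 := by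
    have : 12 + 48 * n ^ 2 ≤ 48 * (n + 1) ^ 3 := by nlinarith only [hn, hn1]
    exact mul_le_mul_of_nonneg_right (mul_le_mul_of_nonneg_right this hL4.le) hP0
  have t4 : 12 * Γ ≤ 12 * (n + 1) * Γ := by nlinarith only [hn, hΓ]
  rw [e2] at t2
  nlinarith only [hW1, t1, t2, t3, t4, hn, hP0, hΓ, hL4]

end RealAux

/-! ### Partial derivatives of products -/

section Leibniz

variable {f g : E → ℝ} {x : E}

/-- `∂ᵥ(fg) = (∂ᵥf) g + f ∂ᵥg`. [folklore] -/
theorem fderiv_mul_apply' (hf : DifferentiableAt ℝ f x) (hg : DifferentiableAt ℝ g x) (v : E) :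
    fderiv ℝ (fun y => f y * g y) x v = fderiv ℝ f x v * g x + f x * fderiv ℝ g x v := by
  rw [fderiv_fun_mul hf hg]
  simp only [_root_.add_apply, FunLike.coe_smul, Pi.smul_apply, smul_eq_mul]
  ring

/-- The partial derivative `y ↦ ∂ᵥ f(y)` of a `C^{n+1}` function is `Cⁿ`. [folklore] -/
theorem contDiff_fderiv_apply_const {n : ℕ∞} (hf : ContDiff ℝ (n + 1) f) (v : E) :
    ContDiff ℝ n fun y => fderiv ℝ f y v :=
  (hf.fderiv_right (m := n) le_rfl).clm_apply contDiff_const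

/-- **Second partial derivatives of a product**: for `f, g ∈ C²`,
`∂_w∂ᵥ(fg) = f ∂_w∂ᵥg + ∂_w f ∂ᵥg + ∂ᵥf ∂_w g + g ∂_w∂ᵥ f`. [folklore] -/
theorem fderiv_fderiv_mul_apply (hf : ContDiff ℝ 2 f) (hg : ContDiff ℝ 2 g) (x v w : E) :
    fderiv ℝ (fun y => fderiv ℝ (fun z => f z * g z) y v) x w =
      f x * fderiv ℝ (fun y => fderiv ℝ g y v) x w
        + fderiv ℝ f x w * fderiv ℝ g x v + fderiv ℝ f x v * fderiv ℝ g x w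
        + g x * fderiv ℝ (fun y => fderiv ℝ f y v) x w := by
  have hf1 : ContDiff ℝ 1 f := hf.of_le one_le_two
  have hg1 : ContDiff ℝ 1 g := hg.of_le one_le_two
  have hfd : ∀ y, DifferentiableAt ℝ f y := fun y => hf1.differentiable one_ne_zero y
  have hgd : ∀ y, DifferentiableAt ℝ g y := fun y => hg1.differentiable one_ne_zero y
  have hfa : ContDiff ℝ 1 fun y => fderiv ℝ f y v :=
    contDiff_fderiv_apply_const (n := 1) (by exact_mod_cast hf) v
  have hga : ContDiff ℝ 1 fun y => fderiv ℝ g y v :=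
    contDiff_fderiv_apply_const (n := 1) (by exact_mod_cast hg) v
  have h1 : (fun y => fderiv ℝ (fun z => f z * g z) y v) =
      fun y => fderiv ℝ f y v * g y + f y * fderiv ℝ g y v := by
    funext y
    exact fderiv_mul_apply' (hfd y) (hgd y) v
  rw [h1]
  have hA : DifferentiableAt ℝ (fun y => fderiv ℝ f y v * g y) x :=
    (hfa.differentiable one_ne_zero x).mul (hgd x)
  have hB : DifferentiableAt ℝ (fun y => f y * fderiv ℝ g y v) x :=
    (hfd x).mul (hga.differentiable one_ne_zero x)
  rw [fderiv_fun_add hA hB, _root_.add_apply,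
    fderiv_mul_apply' (hfa.differentiable one_ne_zero x) (hgd x),
    fderiv_mul_apply' (hfd x) (hga.differentiable one_ne_zero x)]
  ring

/-- `∂ᵥ(η²) = 2 η ∂ᵥη`. [folklore] -/
theorem fderiv_sq_apply {η : E → ℝ} (hη : DifferentiableAt ℝ η x) (v : E) :
    fderiv ℝ (fun y => η y ^ 2) x v = 2 * η x * fderiv ℝ η x v := by
  have : (fun y => η y ^ 2) = fun y => η y * η y := funext fun y => sq (η y)
  rw [this, fderiv_mul_apply' hη hη v]
  ring

/-- `∂_w∂ᵥ(η²) = 2 ∂_w η ∂ᵥ η + 2 η ∂_w∂ᵥ η`. [folklore] -/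
theorem fderiv_fderiv_sq_apply {η : E → ℝ} (hη : ContDiff ℝ 2 η) (x v w : E) :
    fderiv ℝ (fun y => fderiv ℝ (fun z => η z ^ 2) y v) x w =
      2 * fderiv ℝ η x w * fderiv ℝ η x v + 2 * η x * fderiv ℝ (fun y => fderiv ℝ η y v) x w := by
  have : (fun z => η z ^ 2) = fun z => η z * η z := funext fun z => sq (η z)
  rw [this, fderiv_fderiv_mul_apply hη hη x v w]
  ring

end Leibniz


/-! ### Pointwise bounds for the cut-off product `w = η² u` -/

section CutoffPointwise

variable {ι : Type*} [Fintype ι] (b : OrthonormalBasis ι ℝ E) {u η : E → ℝ} {L : ℝ}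

/-- **The weighted Hessian through the Hessian of the cut-off product.** For `u, η ∈ C²` and
`w = η² u`: `η² ∂ⱼ∂ᵢu = ∂ⱼ∂ᵢw − ∂ⱼ(η²) ∂ᵢu − ∂ᵢ(η²) ∂ⱼu − u ∂ⱼ∂ᵢ(η²)`. [folklore] -/
theorem sq_mul_fderiv_fderiv_eq (hu : ContDiff ℝ 2 u) (hη : ContDiff ℝ 2 η) (x : E) (i j : ι) :
    η x ^ 2 * fderiv ℝ (fun y => fderiv ℝ u y (b i)) x (b j) =
      fderiv ℝ (fun y => fderiv ℝ (fun z => η z ^ 2 * u z) y (b i)) x (b j)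
        - 2 * η x * fderiv ℝ η x (b j) * fderiv ℝ u x (b i)
        - 2 * η x * fderiv ℝ η x (b i) * fderiv ℝ u x (b j)
        - u x * (2 * fderiv ℝ η x (b j) * fderiv ℝ η x (b i)
            + 2 * η x * fderiv ℝ (fun y => fderiv ℝ η y (b i)) x (b j)) := by
  have hθ : ContDiff ℝ 2 fun z => η z ^ 2 := hη.pow 2
  have hη1 : ∀ y, DifferentiableAt ℝ η y := fun y =>
    (hη.of_le one_le_two).differentiable one_ne_zero y
  rw [fderiv_fderiv_mul_apply hθ hu x (b i) (b j), fderiv_sq_apply (hη1 x),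
    fderiv_sq_apply (hη1 x), fderiv_fderiv_sq_apply hη]
  ring

/-- **Pointwise weighted Hessian bound.** If `|η| ≤ 1`, `|∂ᵢη| ≤ L` and `|∂ⱼ∂ᵢη| ≤ L²`
componentwise, then for `w = η²u`,
`η⁴ Σᵢⱼ (∂ⱼ∂ᵢu)² ≤ 4 Σᵢⱼ (∂ⱼ∂ᵢw)² + 32 n L² η² Σᵢ (∂ᵢu)² + 64 n² L⁴ u²` (`n = card ι`).
[folklore] -/
theorem pow_four_mul_sum_sq_fderiv_fderiv_le (hu : ContDiff ℝ 2 u) (hη : ContDiff ℝ 2 η)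
    (hη1 : ∀ x, |η x| ≤ 1) (hηL : ∀ x i, |fderiv ℝ η x (b i)| ≤ L)
    (hηL2 : ∀ x i j, |fderiv ℝ (fun y => fderiv ℝ η y (b i)) x (b j)| ≤ L ^ 2) (x : E) :
    η x ^ 4 * ∑ i, ∑ j, (fderiv ℝ (fun y => fderiv ℝ u y (b i)) x (b j)) ^ 2 ≤
      4 * ∑ i, ∑ j, (fderiv ℝ (fun y => fderiv ℝ (fun z => η z ^ 2 * u z) y (b i)) x (b j)) ^ 2
        + 32 * Fintype.card ι * L ^ 2 * (η x ^ 2 * ∑ i, (fderiv ℝ u x (b i)) ^ 2)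
        + 64 * (Fintype.card ι : ℝ) ^ 2 * L ^ 4 * u x ^ 2 := by
  classical
  -- abbreviations
  set W : ι → ι → ℝ := fun i j =>
    fderiv ℝ (fun y => fderiv ℝ (fun z => η z ^ 2 * u z) y (b i)) x (b j) with hW
  set M : ι → ι → ℝ := fun i j => fderiv ℝ (fun y => fderiv ℝ u y (b i)) x (b j) with hM
  set D : ι → ℝ := fun i => fderiv ℝ u x (b i) with hD
  set e : ι → ℝ := fun i => fderiv ℝ η x (b i) with he
  set e2 : ι → ι → ℝ := fun i j => fderiv ℝ (fun y => fderiv ℝ η y (b i)) x (b j) with he2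
  have hL : ∀ i : ι, 0 ≤ L := fun i => (abs_nonneg _).trans (hηL x i)
  -- the bound for each pair `(i, j)`
  have key : ∀ i j, η x ^ 4 * M i j ^ 2 ≤
      4 * W i j ^ 2 + 16 * L ^ 2 * (η x ^ 2 * D i ^ 2) + 16 * L ^ 2 * (η x ^ 2 * D j ^ 2)
        + 64 * L ^ 4 * u x ^ 2 := by
    intro i j
    have hid : η x ^ 2 * M i j =
        W i j - 2 * η x * e j * D i - 2 * η x * e i * D j
          - u x * (2 * e j * e i + 2 * η x * e2 i j) := by
      simp only [hW, hM, hD, he, he2]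
      exact sq_mul_fderiv_fderiv_eq b hu hη x i j
    have h4 := sq_sub_sub_sub_le (W i j) (2 * η x * e j * D i) (2 * η x * e i * D j)
      (u x * (2 * e j * e i + 2 * η x * e2 i j))
    rw [← hid] at h4
    have hej : e j ^ 2 ≤ L ^ 2 := by
      rw [← sq_abs]; exact pow_le_pow_left₀ (abs_nonneg _) (hηL x j) 2
    have hei : e i ^ 2 ≤ L ^ 2 := by
      rw [← sq_abs]; exact pow_le_pow_left₀ (abs_nonneg _) (hηL x i) 2
    have hB : (2 * η x * e j * D i) ^ 2 ≤ 4 * L ^ 2 * (η x ^ 2 * D i ^ 2) := by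
      calc (2 * η x * e j * D i) ^ 2 = 4 * e j ^ 2 * (η x ^ 2 * D i ^ 2) := by ring
        _ ≤ 4 * L ^ 2 * (η x ^ 2 * D i ^ 2) := by gcongr
    have hC : (2 * η x * e i * D j) ^ 2 ≤ 4 * L ^ 2 * (η x ^ 2 * D j ^ 2) := by
      calc (2 * η x * e i * D j) ^ 2 = 4 * e i ^ 2 * (η x ^ 2 * D j ^ 2) := by ring
        _ ≤ 4 * L ^ 2 * (η x ^ 2 * D j ^ 2) := by gcongr
    have habs : |2 * e j * e i + 2 * η x * e2 i j| ≤ 4 * L ^ 2 := by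
      calc |2 * e j * e i + 2 * η x * e2 i j|
          ≤ |2 * e j * e i| + |2 * η x * e2 i j| := abs_add_le _ _
        _ = 2 * (|e j| * |e i|) + 2 * (|η x| * |e2 i j|) := by
            simp only [abs_mul, abs_two]; ring
        _ ≤ 2 * (L * L) + 2 * (1 * L ^ 2) :=
            add_le_add
              (mul_le_mul_of_nonneg_left
                (mul_le_mul (hηL x j) (hηL x i) (abs_nonneg _) (hL i)) two_pos.le)
              (mul_le_mul_of_nonneg_left
                (mul_le_mul (hη1 x) (hηL2 x i j) (abs_nonneg _) zero_le_one) two_pos.le)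
        _ = 4 * L ^ 2 := by ring
    have hDD : (u x * (2 * e j * e i + 2 * η x * e2 i j)) ^ 2 ≤ 16 * L ^ 4 * u x ^ 2 := by
      have h1 : (2 * e j * e i + 2 * η x * e2 i j) ^ 2 ≤ (4 * L ^ 2) ^ 2 := by
        rw [← sq_abs]; exact pow_le_pow_left₀ (abs_nonneg _) habs 2
      calc (u x * (2 * e j * e i + 2 * η x * e2 i j)) ^ 2
          = u x ^ 2 * (2 * e j * e i + 2 * η x * e2 i j) ^ 2 := by ring
        _ ≤ u x ^ 2 * (4 * L ^ 2) ^ 2 := by gcongr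
        _ = 16 * L ^ 4 * u x ^ 2 := by ring
    have hlhs : η x ^ 4 * M i j ^ 2 = (η x ^ 2 * M i j) ^ 2 := by ring
    rw [hlhs]
    linarith
  -- sum over `(i, j)`
  have hsum : ∑ i, ∑ j, η x ^ 4 * M i j ^ 2 ≤
      ∑ i, ∑ j, (4 * W i j ^ 2 + 16 * L ^ 2 * (η x ^ 2 * D i ^ 2)
        + 16 * L ^ 2 * (η x ^ 2 * D j ^ 2) + 64 * L ^ 4 * u x ^ 2) :=
    Finset.sum_le_sum fun i _ => Finset.sum_le_sum fun j _ => key i j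
  calc η x ^ 4 * ∑ i, ∑ j, M i j ^ 2 = ∑ i, ∑ j, η x ^ 4 * M i j ^ 2 := by
        simp_rw [Finset.mul_sum]
    _ ≤ _ := hsum
    _ = 4 * ∑ i, ∑ j, W i j ^ 2 + 32 * Fintype.card ι * L ^ 2 * (η x ^ 2 * ∑ i, D i ^ 2)
          + 64 * (Fintype.card ι : ℝ) ^ 2 * L ^ 4 * u x ^ 2 := by
        simp only [Finset.sum_add_distrib, Finset.sum_const, Finset.card_univ, nsmul_eq_mul,
          ← Finset.mul_sum]
        ring

variable [FiniteDimensional ℝ E]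

/-- **Pointwise bound for the Laplacian of the cut-off product.** Under the same bounds on `η`,
for `w = η²u`: `(Δw)² ≤ 3 η⁴ (Δu)² + 48 n L² η² Σᵢ (∂ᵢu)² + 48 n² L⁴ u²`. [folklore] -/
theorem sq_laplacian_cutoff_mul_le (hu : ContDiff ℝ 2 u) (hη : ContDiff ℝ 2 η)
    (hη1 : ∀ x, |η x| ≤ 1) (hηL : ∀ x i, |fderiv ℝ η x (b i)| ≤ L)
    (hηL2 : ∀ x i j, |fderiv ℝ (fun y => fderiv ℝ η y (b i)) x (b j)| ≤ L ^ 2) (x : E) :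
    ((Δ fun y => η y ^ 2 * u y) x) ^ 2 ≤
      3 * (η x ^ 4 * ((Δ u) x) ^ 2)
        + 48 * Fintype.card ι * L ^ 2 * (η x ^ 2 * ∑ i, (fderiv ℝ u x (b i)) ^ 2)
        + 48 * (Fintype.card ι : ℝ) ^ 2 * L ^ 4 * u x ^ 2 := by
  classical
  set D : ι → ℝ := fun i => fderiv ℝ u x (b i) with hD
  set e : ι → ℝ := fun i => fderiv ℝ η x (b i) with he
  set e2 : ι → ι → ℝ := fun i j => fderiv ℝ (fun y => fderiv ℝ η y (b i)) x (b j) with he2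
  have hL : ∀ i : ι, 0 ≤ L := fun i => (abs_nonneg _).trans (hηL x i)
  have hθ : ContDiff ℝ 2 fun z => η z ^ 2 := hη.pow 2
  have hη1d : ∀ y, DifferentiableAt ℝ η y := fun y =>
    (hη.of_le one_le_two).differentiable one_ne_zero y
  -- the Leibniz formula
  have hlap : (Δ fun y => η y ^ 2 * u y) x =
      η x ^ 2 * (Δ u) x + u x * (Δ fun y => η y ^ 2) x + 2 * ∑ i, 2 * η x * e i * D i := by
    rw [laplacian_mul_eq b hθ hu x]
    congr 1
    congr 1
    refine Finset.sum_congr rfl fun i _ => ?_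
    rw [fderiv_sq_apply (hη1d x)]
  -- `Δ(η²) = Σᵢ (2 (∂ᵢη)² + 2 η ∂ᵢ∂ᵢη)`, bounded by `4 n L²`
  have hΔθ : (Δ fun y => η y ^ 2) x = ∑ i, (2 * e i * e i + 2 * η x * e2 i i) := by
    rw [laplacian_eq_sum_fderiv_fderiv b hθ x]
    exact Finset.sum_congr rfl fun i _ => fderiv_fderiv_sq_apply hη x (b i) (b i)
  have hΔθ_sq : ((Δ fun y => η y ^ 2) x) ^ 2 ≤ (Fintype.card ι : ℝ) ^ 2 * (4 * L ^ 2) ^ 2 := by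
    rw [hΔθ]
    refine sq_sum_le_card_sq_mul fun i => ?_
    calc |2 * e i * e i + 2 * η x * e2 i i|
        ≤ |2 * e i * e i| + |2 * η x * e2 i i| := abs_add_le _ _
      _ = 2 * (|e i| * |e i|) + 2 * (|η x| * |e2 i i|) := by
          simp only [abs_mul, abs_two]; ring
      _ ≤ 2 * (L * L) + 2 * (1 * L ^ 2) :=
          add_le_add
            (mul_le_mul_of_nonneg_left
              (mul_le_mul (hηL x i) (hηL x i) (abs_nonneg _) (hL i)) two_pos.le)
            (mul_le_mul_of_nonneg_left
              (mul_le_mul (hη1 x) (hηL2 x i i) (abs_nonneg _) zero_le_one) two_pos.le)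
      _ = 4 * L ^ 2 := by ring
  -- the cross term
  have hcross : (2 * ∑ i, 2 * η x * e i * D i) ^ 2 ≤
      16 * Fintype.card ι * L ^ 2 * (η x ^ 2 * ∑ i, D i ^ 2) := by
    have hcs := sq_sum_mul_le Finset.univ (fun i => 2 * η x * e i) D
    have hsum : ∑ i, (2 * η x * e i) ^ 2 ≤ Fintype.card ι * (4 * η x ^ 2 * L ^ 2) := by
      calc ∑ i, (2 * η x * e i) ^ 2 ≤ ∑ _i : ι, 4 * η x ^ 2 * L ^ 2 := by
            refine Finset.sum_le_sum fun i _ => ?_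
            have hei : e i ^ 2 ≤ L ^ 2 := by
              rw [← sq_abs]; exact pow_le_pow_left₀ (abs_nonneg _) (hηL x i) 2
            calc (2 * η x * e i) ^ 2 = 4 * η x ^ 2 * e i ^ 2 := by ring
              _ ≤ 4 * η x ^ 2 * L ^ 2 := by gcongr
        _ = Fintype.card ι * (4 * η x ^ 2 * L ^ 2) := by
            rw [Finset.sum_const, nsmul_eq_mul, Finset.card_univ]
    have hD0 : 0 ≤ ∑ i, D i ^ 2 := Finset.sum_nonneg fun i _ => sq_nonneg _
    calc (2 * ∑ i, 2 * η x * e i * D i) ^ 2 = 4 * (∑ i, 2 * η x * e i * D i) ^ 2 := by ring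
      _ ≤ 4 * ((∑ i, (2 * η x * e i) ^ 2) * ∑ i, D i ^ 2) := by gcongr
      _ ≤ 4 * (Fintype.card ι * (4 * η x ^ 2 * L ^ 2) * ∑ i, D i ^ 2) := by gcongr
      _ = 16 * Fintype.card ι * L ^ 2 * (η x ^ 2 * ∑ i, D i ^ 2) := by ring
  -- assemble
  have h3 : ∀ p q r : ℝ, (p + q + r) ^ 2 ≤ 3 * (p ^ 2 + q ^ 2 + r ^ 2) := fun p q r => by
    nlinarith [sq_nonneg (p - q), sq_nonneg (p - r), sq_nonneg (q - r)]
  have h3 := h3 (η x ^ 2 * (Δ u) x) (u x * (Δ fun y => η y ^ 2) x)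
    (2 * ∑ i, 2 * η x * e i * D i)
  rw [← hlap] at h3
  have hb : (u x * (Δ fun y => η y ^ 2) x) ^ 2 ≤ 16 * (Fintype.card ι : ℝ) ^ 2 * L ^ 4 * u x ^ 2 := by
    calc (u x * (Δ fun y => η y ^ 2) x) ^ 2 = u x ^ 2 * ((Δ fun y => η y ^ 2) x) ^ 2 := by ring
      _ ≤ u x ^ 2 * ((Fintype.card ι : ℝ) ^ 2 * (4 * L ^ 2) ^ 2) := by gcongr
      _ = 16 * (Fintype.card ι : ℝ) ^ 2 * L ^ 4 * u x ^ 2 := by ring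
  have ha : (η x ^ 2 * (Δ u) x) ^ 2 = η x ^ 4 * ((Δ u) x) ^ 2 := by ring
  rw [ha] at h3
  linarith

variable {ε : ℝ} {G : E → ℝ}

/-- **Squaring the Laplacian inequality.** If
`|Δu| ≤ ε √(Σᵢⱼ(∂ⱼ∂ᵢu)²) + L √(Σᵢ(∂ᵢu)²) + L² |u| + G` at `x` and `|η x| ≤ 1`, then
`η⁴ (Δu)² ≤ 4 ε² η⁴ Σᵢⱼ(∂ⱼ∂ᵢu)² + 4 L² η² Σᵢ(∂ᵢu)² + 4 L⁴ η² u² + 4 η² G²` at `x`.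
[folklore] -/
theorem pow_four_mul_sq_laplacian_le {x : E} (hη1 : |η x| ≤ 1)
    (hΔ : |(Δ u) x| ≤
      ε * Real.sqrt (∑ i, ∑ j, (fderiv ℝ (fun y => fderiv ℝ u y (b i)) x (b j)) ^ 2)
        + L * Real.sqrt (∑ i, (fderiv ℝ u x (b i)) ^ 2) + L ^ 2 * |u x| + G x) :
    η x ^ 4 * ((Δ u) x) ^ 2 ≤
      4 * ε ^ 2 * (η x ^ 4 * ∑ i, ∑ j, (fderiv ℝ (fun y => fderiv ℝ u y (b i)) x (b j)) ^ 2)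
        + 4 * L ^ 2 * (η x ^ 2 * ∑ i, (fderiv ℝ u x (b i)) ^ 2)
        + 4 * L ^ 4 * (η x ^ 2 * u x ^ 2) + 4 * (η x ^ 2 * G x ^ 2) := by
  set H2 : ℝ := ∑ i, ∑ j, (fderiv ℝ (fun y => fderiv ℝ u y (b i)) x (b j)) ^ 2 with hH2
  set H1 : ℝ := ∑ i, (fderiv ℝ u x (b i)) ^ 2 with hH1
  have hH2n : 0 ≤ H2 := Finset.sum_nonneg fun i _ => Finset.sum_nonneg fun j _ => sq_nonneg _
  have hH1n : 0 ≤ H1 := Finset.sum_nonneg fun i _ => sq_nonneg _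
  have hsq : ((Δ u) x) ^ 2 ≤ 4 * (ε ^ 2 * H2 + L ^ 2 * H1 + L ^ 4 * u x ^ 2 + G x ^ 2) := by
    have h0 : ((Δ u) x) ^ 2 ≤
        (ε * Real.sqrt H2 + L * Real.sqrt H1 + L ^ 2 * |u x| + G x) ^ 2 := by
      have := pow_le_pow_left₀ (abs_nonneg _) hΔ 2
      rwa [sq_abs] at this
    have h4 : ∀ p q r t : ℝ, (p + q + r + t) ^ 2 ≤ 4 * (p ^ 2 + q ^ 2 + r ^ 2 + t ^ 2) :=
      fun p q r t => by
        nlinarith [sq_nonneg (p - q), sq_nonneg (p - r), sq_nonneg (p - t), sq_nonneg (q - r),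
          sq_nonneg (q - t), sq_nonneg (r - t)]
    have h4 := h4 (ε * Real.sqrt H2) (L * Real.sqrt H1) (L ^ 2 * |u x|) (G x)
    have e1 : (ε * Real.sqrt H2) ^ 2 = ε ^ 2 * H2 := by rw [mul_pow, Real.sq_sqrt hH2n]
    have e2 : (L * Real.sqrt H1) ^ 2 = L ^ 2 * H1 := by rw [mul_pow, Real.sq_sqrt hH1n]
    have e3 : (L ^ 2 * |u x|) ^ 2 = L ^ 4 * u x ^ 2 := by rw [mul_pow, sq_abs]; ring
    rw [e1, e2, e3] at h4
    exact h0.trans h4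
  have hη2 : η x ^ 2 ≤ 1 := by
    have := pow_le_pow_left₀ (abs_nonneg _) hη1 2
    rwa [sq_abs, one_pow] at this
  have hη4 : η x ^ 4 ≤ η x ^ 2 := by
    calc η x ^ 4 = η x ^ 2 * η x ^ 2 := by ring
      _ ≤ η x ^ 2 * 1 := by gcongr
      _ = η x ^ 2 := mul_one _
  have hη4n : 0 ≤ η x ^ 4 := by positivity
  have hmul := mul_le_mul_of_nonneg_left hsq hη4n
  have t1 : η x ^ 4 * (L ^ 2 * H1) ≤ η x ^ 2 * (L ^ 2 * H1) :=
    mul_le_mul_of_nonneg_right hη4 (by positivity)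
  have t2 : η x ^ 4 * (L ^ 4 * u x ^ 2) ≤ η x ^ 2 * (L ^ 4 * u x ^ 2) :=
    mul_le_mul_of_nonneg_right hη4 (by positivity)
  have t3 : η x ^ 4 * G x ^ 2 ≤ η x ^ 2 * G x ^ 2 :=
    mul_le_mul_of_nonneg_right hη4 (sq_nonneg _)
  nlinarith [hmul, t1, t2, t3]

/-- **Pointwise Young bounds for the Caccioppoli right-hand side.** If
`|Δu| ≤ ε √(Σᵢⱼ(∂ⱼ∂ᵢu)²) + L √(Σᵢ(∂ᵢu)²) + L² |u| + G` at `x`, `|η x| ≤ 1`, `L > 0`, `κ > 0` and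
`ε ≥ 0`, then `2 η² |u| |Δu| ≤ (εκ + 7) L² u² + (ε/(κL²)) η⁴ Σᵢⱼ(∂ⱼ∂ᵢu)² + η² Σᵢ(∂ᵢu)²/4
+ η² G²/L²` at `x`. [folklore] -/
theorem two_mul_cutoff_sq_mul_abs_mul_abs_laplacian_le {x : E} {κ : ℝ} (hκ : 0 < κ) (hL : 0 < L)
    (hε0 : 0 ≤ ε) (hη1 : |η x| ≤ 1)
    (hΔ : |(Δ u) x| ≤
      ε * Real.sqrt (∑ i, ∑ j, (fderiv ℝ (fun y => fderiv ℝ u y (b i)) x (b j)) ^ 2)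
        + L * Real.sqrt (∑ i, (fderiv ℝ u x (b i)) ^ 2) + L ^ 2 * |u x| + G x) :
    2 * (η x ^ 2 * |u x| * |(Δ u) x|) ≤
      (ε * κ + 7) * L ^ 2 * u x ^ 2
        + ε / (κ * L ^ 2)
          * (η x ^ 4 * ∑ i, ∑ j, (fderiv ℝ (fun y => fderiv ℝ u y (b i)) x (b j)) ^ 2)
        + (η x ^ 2 * ∑ i, (fderiv ℝ u x (b i)) ^ 2) / 4 + (η x ^ 2 * G x ^ 2) / L ^ 2 := by
  set H2 : ℝ := ∑ i, ∑ j, (fderiv ℝ (fun y => fderiv ℝ u y (b i)) x (b j)) ^ 2 with hH2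
  set H1 : ℝ := ∑ i, (fderiv ℝ u x (b i)) ^ 2 with hH1
  have hH2n : 0 ≤ H2 := Finset.sum_nonneg fun i _ => Finset.sum_nonneg fun j _ => sq_nonneg _
  have hH1n : 0 ≤ H1 := Finset.sum_nonneg fun i _ => sq_nonneg _
  set a : ℝ := |u x| with ha
  have ha0 : 0 ≤ a := abs_nonneg _
  have ha2 : a ^ 2 = u x ^ 2 := sq_abs _
  have hη2 : η x ^ 2 ≤ 1 := by
    have := pow_le_pow_left₀ (abs_nonneg _) hη1 2
    rwa [sq_abs, one_pow] at this
  have hη2n : 0 ≤ η x ^ 2 := sq_nonneg _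
  have hη4 : η x ^ 4 ≤ η x ^ 2 := by
    calc η x ^ 4 = η x ^ 2 * η x ^ 2 := by ring
      _ ≤ η x ^ 2 * 1 := by gcongr
      _ = η x ^ 2 := mul_one _
  have hL2 : 0 < L ^ 2 := by positivity
  -- multiply the hypothesis by `2 η² |u| ≥ 0`
  have hmul : 2 * (η x ^ 2 * a * |(Δ u) x|) ≤
      2 * (η x ^ 2 * a) * (ε * Real.sqrt H2 + L * Real.sqrt H1 + L ^ 2 * a + G x) := by
    have := mul_le_mul_of_nonneg_left hΔ (by positivity : 0 ≤ 2 * (η x ^ 2 * a))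
    linarith
  -- the four Young inequalities
  have hT1 : 2 * (η x ^ 2 * a) * (ε * Real.sqrt H2) ≤
      ε * κ * L ^ 2 * a ^ 2 + ε / (κ * L ^ 2) * (η x ^ 4 * H2) := by
    have hy := two_mul_le_add_sq_div (mul_pos hκ hL2) a (η x ^ 2 * Real.sqrt H2)
    have e : (η x ^ 2 * Real.sqrt H2) ^ 2 = η x ^ 4 * H2 := by
      rw [mul_pow, Real.sq_sqrt hH2n]; ring
    rw [e] at hy
    have hy' := mul_le_mul_of_nonneg_left hy hε0
    have e2 : ε * (κ * L ^ 2 * a ^ 2 + η x ^ 4 * H2 / (κ * L ^ 2)) =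
        ε * κ * L ^ 2 * a ^ 2 + ε / (κ * L ^ 2) * (η x ^ 4 * H2) := by
      field_simp
    rw [e2] at hy'
    linarith
  have hT2 : 2 * (η x ^ 2 * a) * (L * Real.sqrt H1) ≤ 4 * L ^ 2 * a ^ 2 + η x ^ 2 * H1 / 4 := by
    have hy := two_mul_le_add_sq_div (by norm_num : (0:ℝ) < 4) (L * a) (η x ^ 2 * Real.sqrt H1)
    have e : (η x ^ 2 * Real.sqrt H1) ^ 2 = η x ^ 4 * H1 := by
      rw [mul_pow, Real.sq_sqrt hH1n]; ring
    rw [e] at hy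
    have h4 : η x ^ 4 * H1 / 4 ≤ η x ^ 2 * H1 / 4 := by
      gcongr
    nlinarith [hy, h4]
  have hT3 : 2 * (η x ^ 2 * a) * (L ^ 2 * a) ≤ 2 * L ^ 2 * a ^ 2 := by
    have : η x ^ 2 * a ^ 2 ≤ 1 * a ^ 2 := mul_le_mul_of_nonneg_right hη2 (sq_nonneg _)
    nlinarith
  have hT4 : 2 * (η x ^ 2 * a) * G x ≤ L ^ 2 * a ^ 2 + η x ^ 2 * G x ^ 2 / L ^ 2 := by
    have hy := two_mul_le_add_sq_div hL2 a (η x ^ 2 * G x)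
    have e : (η x ^ 2 * G x) ^ 2 = η x ^ 4 * G x ^ 2 := by ring
    rw [e] at hy
    have h4 : η x ^ 4 * G x ^ 2 / L ^ 2 ≤ η x ^ 2 * G x ^ 2 / L ^ 2 := by
      gcongr
    nlinarith [hy, h4]
  have hsum : 2 * (η x ^ 2 * a) * (ε * Real.sqrt H2 + L * Real.sqrt H1 + L ^ 2 * a + G x) =
      2 * (η x ^ 2 * a) * (ε * Real.sqrt H2) + 2 * (η x ^ 2 * a) * (L * Real.sqrt H1)
        + 2 * (η x ^ 2 * a) * (L ^ 2 * a) + 2 * (η x ^ 2 * a) * G x := by ring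
  rw [hsum] at hmul
  rw [← ha2]
  have e3 : (η x ^ 2 * H1) / 4 = η x ^ 2 * H1 / 4 := rfl
  linarith [hmul, hT1, hT2, hT3, hT4]

end CutoffPointwise


/-! ### Integrated estimates -/

section Energy

variable [FiniteDimensional ℝ E] [MeasurableSpace E] [BorelSpace E]
  {ι : Type*} [Fintype ι] (b : OrthonormalBasis ι ℝ E) {u η : E → ℝ}

omit [FiniteDimensional ℝ E] [MeasurableSpace E] [BorelSpace E] in
/-- Off the topological support of `η`, the function and its first two partial derivatives
vanish. [folklore] -/
theorem eq_zero_of_notMem_tsupport_cutoff {x : E} (hx : x ∉ tsupport η) (v w : E) :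
    η x = 0 ∧ fderiv ℝ η x v = 0 ∧ fderiv ℝ (fun y => fderiv ℝ η y v) x w = 0 := by
  refine ⟨image_eq_zero_of_notMem_tsupport hx, ?_, ?_⟩
  · rw [fderiv_of_notMem_tsupport ℝ hx]; rfl
  · have hx' : x ∉ tsupport fun y => fderiv ℝ η y v :=
      fun h => hx (tsupport_fderiv_apply_subset ℝ v h)
    rw [fderiv_of_notMem_tsupport ℝ hx']; rfl

/-- A continuous function vanishing off the (compact) topological support of `η` is integrable.
[folklore] -/
theorem integrable_of_continuous_of_tsupport {F : E → ℝ} (hηc : HasCompactSupport η)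
    (hF : Continuous F) (h0 : ∀ x ∉ tsupport η, F x = 0) : Integrable F :=
  hF.integrable_of_hasCompactSupport (HasCompactSupport.intro hηc h0)

/-- **The cut-off energy identity** (Green's first identity tested with `η² u`): for `u ∈ C²`
and `η ∈ C¹_c`,
`∫ η² Σᵢ (∂ᵢu)² = -∫ η² u Δu - 2 ∫ η u Σᵢ ∂ᵢη ∂ᵢu`. [folklore] -/
theorem integral_cutoff_sq_mul_sum_sq_fderiv_eq (hu : ContDiff ℝ 2 u) (hη : ContDiff ℝ 1 η)
    (hηc : HasCompactSupport η) :
    ∫ x, η x ^ 2 * ∑ i, (fderiv ℝ u x (b i)) ^ 2 =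
      -(∫ x, η x ^ 2 * u x * (Δ u) x)
        - 2 * ∫ x, η x * u x * ∑ i, fderiv ℝ η x (b i) * fderiv ℝ u x (b i) := by
  -- continuity and differentiability
  have hηcont : Continuous η := hη.continuous
  have hucont : Continuous u := hu.continuous
  have hDu : ∀ v, Continuous fun x => fderiv ℝ u x v := fun v =>
    (hu.continuous_fderiv two_ne_zero).clm_apply continuous_const
  have hDη : ∀ v, Continuous fun x => fderiv ℝ η x v := fun v =>
    (hη.continuous_fderiv one_ne_zero).clm_apply continuous_const
  have hη1d : ∀ y, DifferentiableAt ℝ η y := fun y => hη.differentiable one_ne_zero y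
  have hu1d : ∀ y, DifferentiableAt ℝ u y := fun y => hu.differentiable two_ne_zero y
  have hθd : ∀ y, DifferentiableAt ℝ (fun z => η z ^ 2) y := fun y => (hη1d y).pow 2
  have h0 : ∀ x ∉ tsupport η, η x = 0 := fun x hx => image_eq_zero_of_notMem_tsupport hx
  -- the test function `w = η² u`
  have hθ : ContDiff ℝ 1 fun y => η y ^ 2 := hη.pow 2
  have hw : ContDiff ℝ 1 fun y => η y ^ 2 * u y := hθ.mul (hu.of_le one_le_two)
  have hwc : HasCompactSupport fun y => η y ^ 2 * u y :=
    HasCompactSupport.intro hηc fun x hx => by simp [h0 x hx]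
  have hG := integral_inner_laplacian_add_eq_zero b hu hw (Or.inr hwc)
  have hdw : ∀ x i, fderiv ℝ (fun y => η y ^ 2 * u y) x (b i) =
      2 * η x * fderiv ℝ η x (b i) * u x + η x ^ 2 * fderiv ℝ u x (b i) := by
    intro x i
    rw [fderiv_mul_apply' (hθd x) (hu1d x), fderiv_sq_apply (hη1d x)]
  simp only [RCLike.inner_apply, conj_trivial, hdw] at hG
  -- integrability of the pieces
  have hiA : ∀ i, Integrable fun x =>
      2 * η x * fderiv ℝ η x (b i) * u x * fderiv ℝ u x (b i) := fun i =>
    integrable_of_continuous_of_tsupport hηc (by fun_prop) fun x hx => by simp [h0 x hx]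
  have hiB : ∀ i, Integrable fun x => η x ^ 2 * fderiv ℝ u x (b i) * fderiv ℝ u x (b i) :=
    fun i => integrable_of_continuous_of_tsupport hηc (by fun_prop) fun x hx => by simp [h0 x hx]
  have hsplit : ∀ i, ∫ x, (2 * η x * fderiv ℝ η x (b i) * u x + η x ^ 2 * fderiv ℝ u x (b i))
      * fderiv ℝ u x (b i) =
      (∫ x, 2 * η x * fderiv ℝ η x (b i) * u x * fderiv ℝ u x (b i))
        + ∫ x, η x ^ 2 * fderiv ℝ u x (b i) * fderiv ℝ u x (b i) := by
    intro i
    rw [← integral_add (hiA i) (hiB i)]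
    exact integral_congr_ae (Eventually.of_forall fun x => by ring)
  simp only [hsplit, Finset.sum_add_distrib] at hG
  rw [← integral_finsetSum _ fun i _ => hiA i, ← integral_finsetSum _ fun i _ => hiB i] at hG
  -- identify the two sums
  have e1 : (fun x => ∑ i, 2 * η x * fderiv ℝ η x (b i) * u x * fderiv ℝ u x (b i)) =
      fun x => 2 * (η x * u x * ∑ i, fderiv ℝ η x (b i) * fderiv ℝ u x (b i)) := by
    funext x
    rw [Finset.mul_sum, Finset.mul_sum]
    exact Finset.sum_congr rfl fun i _ => by ring
  have e2 : (fun x => ∑ i, η x ^ 2 * fderiv ℝ u x (b i) * fderiv ℝ u x (b i)) =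
      fun x => η x ^ 2 * ∑ i, (fderiv ℝ u x (b i)) ^ 2 := by
    funext x
    rw [Finset.mul_sum]
    exact Finset.sum_congr rfl fun i _ => by ring
  rw [e1, e2, integral_const_mul] at hG
  have e3 : ∫ x, η x ^ 2 * u x * (Δ u) x = ∫ x, η x ^ 2 * u x * (Δ u) x := rfl
  linarith

/-- **Caccioppoli's inequality with a cut-off**: for `u ∈ C²` and `η ∈ C¹_c`,
`∫ η² Σᵢ (∂ᵢu)² ≤ 2 ∫ η² |u| |Δu| + 4 ∫ u² Σᵢ (∂ᵢη)²`. [folklore] -/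
theorem integral_cutoff_sq_mul_sum_sq_fderiv_le (hu : ContDiff ℝ 2 u) (hη : ContDiff ℝ 1 η)
    (hηc : HasCompactSupport η) :
    ∫ x, η x ^ 2 * ∑ i, (fderiv ℝ u x (b i)) ^ 2 ≤
      2 * (∫ x, η x ^ 2 * |u x| * |(Δ u) x|)
        + 4 * ∫ x, u x ^ 2 * ∑ i, (fderiv ℝ η x (b i)) ^ 2 := by
  have hηcont : Continuous η := hη.continuous
  have hucont : Continuous u := hu.continuous
  have hDu : ∀ v, Continuous fun x => fderiv ℝ u x v := fun v =>
    (hu.continuous_fderiv two_ne_zero).clm_apply continuous_const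
  have hDη : ∀ v, Continuous fun x => fderiv ℝ η x v := fun v =>
    (hη.continuous_fderiv one_ne_zero).clm_apply continuous_const
  have hΔu : Continuous (Δ u) := continuous_laplacian hu
  have h0 : ∀ x ∉ tsupport η, η x = 0 := fun x hx => image_eq_zero_of_notMem_tsupport hx
  have h0' : ∀ x ∉ tsupport η, ∀ v, fderiv ℝ η x v = 0 := fun x hx v =>
    (eq_zero_of_notMem_tsupport_cutoff hx v v).2.1
  have hid := integral_cutoff_sq_mul_sum_sq_fderiv_eq b hu hη hηc
  set X := ∫ x, η x ^ 2 * ∑ i, (fderiv ℝ u x (b i)) ^ 2 with hX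
  set A := ∫ x, η x ^ 2 * u x * (Δ u) x with hA
  set B := ∫ x, η x * u x * ∑ i, fderiv ℝ η x (b i) * fderiv ℝ u x (b i) with hB
  set Y := ∫ x, u x ^ 2 * ∑ i, (fderiv ℝ η x (b i)) ^ 2 with hY
  -- `|A| ≤ ∫ η² |u| |Δu|`
  have hAle : |A| ≤ ∫ x, η x ^ 2 * |u x| * |(Δ u) x| := by
    refine (abs_integral_le_integral_abs).trans_eq (integral_congr_ae
      (Eventually.of_forall fun x => ?_))
    simp only [abs_mul, abs_pow, sq_abs]
  -- `-2B ≤ 2Y + X/2`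
  have hiX : Integrable fun x => η x ^ 2 * ∑ i, (fderiv ℝ u x (b i)) ^ 2 :=
    integrable_of_continuous_of_tsupport hηc (by fun_prop) fun x hx => by simp [h0 x hx]
  have hiY : Integrable fun x => u x ^ 2 * ∑ i, (fderiv ℝ η x (b i)) ^ 2 :=
    integrable_of_continuous_of_tsupport hηc (by fun_prop) fun x hx => by simp [h0' x hx]
  have hiB : Integrable fun x => η x * u x * ∑ i, fderiv ℝ η x (b i) * fderiv ℝ u x (b i) :=
    integrable_of_continuous_of_tsupport hηc (by fun_prop) fun x hx => by simp [h0 x hx]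
  have hBle : -2 * B ≤ 2 * Y + X / 2 := by
    have hpt : ∀ x, -2 * (η x * u x * ∑ i, fderiv ℝ η x (b i) * fderiv ℝ u x (b i)) ≤
        2 * (u x ^ 2 * ∑ i, (fderiv ℝ η x (b i)) ^ 2)
          + (η x ^ 2 * ∑ i, (fderiv ℝ u x (b i)) ^ 2) / 2 := by
      intro x
      have e1 : ∑ i, 2 * (u x ^ 2 * (fderiv ℝ η x (b i)) ^ 2) =
          2 * (u x ^ 2 * ∑ i, (fderiv ℝ η x (b i)) ^ 2) := by
        rw [Finset.mul_sum, Finset.mul_sum]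
      have e2 : ∑ i, (η x ^ 2 * (fderiv ℝ u x (b i)) ^ 2) / 2 =
          (η x ^ 2 * ∑ i, (fderiv ℝ u x (b i)) ^ 2) / 2 := by
        rw [Finset.mul_sum, Finset.sum_div]
      calc -2 * (η x * u x * ∑ i, fderiv ℝ η x (b i) * fderiv ℝ u x (b i))
          = ∑ i, -2 * (η x * u x * (fderiv ℝ η x (b i) * fderiv ℝ u x (b i))) := by
            rw [Finset.mul_sum, Finset.mul_sum]
        _ ≤ ∑ i, (2 * (u x ^ 2 * (fderiv ℝ η x (b i)) ^ 2)
              + (η x ^ 2 * (fderiv ℝ u x (b i)) ^ 2) / 2) :=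
            Finset.sum_le_sum fun i _ => by
              nlinarith [sq_nonneg (2 * u x * fderiv ℝ η x (b i) + η x * fderiv ℝ u x (b i))]
        _ = 2 * (u x ^ 2 * ∑ i, (fderiv ℝ η x (b i)) ^ 2)
              + (η x ^ 2 * ∑ i, (fderiv ℝ u x (b i)) ^ 2) / 2 := by
            rw [Finset.sum_add_distrib, e1, e2]
    have hig : Integrable fun x => 2 * (u x ^ 2 * ∑ i, (fderiv ℝ η x (b i)) ^ 2)
        + (η x ^ 2 * ∑ i, (fderiv ℝ u x (b i)) ^ 2) / 2 :=
      (hiY.const_mul 2).add (hiX.div_const 2)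
    have h := integral_mono (hiB.const_mul (-2)) hig hpt
    rw [integral_const_mul] at h
    rw [integral_add (hiY.const_mul 2) (hiX.div_const 2), integral_const_mul,
      integral_div] at h
    exact h
  have hXeq : X = -A - 2 * B := hid
  have hA' : -A ≤ |A| := neg_le_abs A
  linarith

variable {S : Set E} {L ε : ℝ} {G : E → ℝ}

/-- Set integrals over a set containing the support of `η` of functions vanishing with `η`.
[folklore] -/
theorem setIntegral_eq_integral_of_tsupport_subset {F : E → ℝ} (hηS : tsupport η ⊆ S)
    (h0 : ∀ x ∉ tsupport η, F x = 0) : ∫ x in S, F x = ∫ x, F x :=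
  setIntegral_eq_integral_of_forall_compl_eq_zero fun x hx => h0 x fun h => hx (hηS h)

/-- **The weighted Hessian energy through the Laplacian of the cut-off product.** For
`u, η ∈ C³`, `η` compactly supported in the compact set `S` with `|η| ≤ 1`, `|∂ᵢη| ≤ L`,
`|∂ⱼ∂ᵢη| ≤ L²`, and `w = η²u`:
`∫ η⁴ Σᵢⱼ(∂ⱼ∂ᵢu)² ≤ 4 ∫ (Δw)² + 32 n L² ∫ η² Σᵢ(∂ᵢu)² + 64 n² L⁴ ∫_S u²`
(the Hessian–Laplacian identity `Σᵢⱼ ∫ (∂ⱼ∂ᵢw)² = ∫ (Δw)²` for `w ∈ C³_c`). [folklore] -/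
theorem integral_pow_four_mul_sum_sq_fderiv_fderiv_le (hu : ContDiff ℝ 3 u) (hη : ContDiff ℝ 3 η)
    (hηc : HasCompactSupport η) (hηS : tsupport η ⊆ S) (hS : IsCompact S)
    (hη1 : ∀ x, |η x| ≤ 1) (hηL : ∀ x i, |fderiv ℝ η x (b i)| ≤ L)
    (hηL2 : ∀ x i j, |fderiv ℝ (fun y => fderiv ℝ η y (b i)) x (b j)| ≤ L ^ 2) :
    ∫ x, η x ^ 4 * ∑ i, ∑ j, (fderiv ℝ (fun y => fderiv ℝ u y (b i)) x (b j)) ^ 2 ≤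
      4 * (∫ x, ((Δ fun y => η y ^ 2 * u y) x) ^ 2)
        + 32 * Fintype.card ι * L ^ 2 * (∫ x, η x ^ 2 * ∑ i, (fderiv ℝ u x (b i)) ^ 2)
        + 64 * (Fintype.card ι : ℝ) ^ 2 * L ^ 4 * ∫ x in S, u x ^ 2 := by
  have hu2 : ContDiff ℝ 2 u := hu.of_le (by norm_num)
  have hη2 : ContDiff ℝ 2 η := hη.of_le (by norm_num)
  have hSm : MeasurableSet S := hS.isClosed.measurableSet
  have h0 : ∀ x ∉ tsupport η, η x = 0 := fun x hx => image_eq_zero_of_notMem_tsupport hx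
  -- the cut-off product
  have hw : ContDiff ℝ 3 fun y => η y ^ 2 * u y := (hη.pow 2).mul hu
  have hw2 : ContDiff ℝ 2 fun y => η y ^ 2 * u y := hw.of_le (by norm_num)
  have hwc : HasCompactSupport fun y => η y ^ 2 * u y :=
    HasCompactSupport.intro hηc fun x hx => by simp [h0 x hx]
  have hHS := integral_sum_sq_fderiv_fderiv_eq_integral_laplacian_sq b hw hwc
  -- continuity of the second partial derivatives
  have hc2u : ∀ i j, Continuous fun x => fderiv ℝ (fun y => fderiv ℝ u y (b i)) x (b j) :=
    fun i j => continuous_fderiv_fderiv_apply hu2 (b i) (b j)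
  have hc2w : ∀ i j, Continuous fun x =>
      fderiv ℝ (fun y => fderiv ℝ (fun z => η z ^ 2 * u z) y (b i)) x (b j) :=
    fun i j => continuous_fderiv_fderiv_apply hw2 (b i) (b j)
  have hc1u : ∀ i, Continuous fun x => fderiv ℝ u x (b i) := fun i =>
    (hu2.continuous_fderiv two_ne_zero).clm_apply continuous_const
  have hηcont : Continuous η := hη.continuous
  have hucont : Continuous u := hu.continuous
  -- the pointwise bound, integrated over `S`
  have hpt := pow_four_mul_sum_sq_fderiv_fderiv_le b hu2 hη2 hη1 hηL hηL2
  set F : E → ℝ := fun x =>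
    η x ^ 4 * ∑ i, ∑ j, (fderiv ℝ (fun y => fderiv ℝ u y (b i)) x (b j)) ^ 2 with hF
  set Hw : E → ℝ := fun x =>
    ∑ i, ∑ j, (fderiv ℝ (fun y => fderiv ℝ (fun z => η z ^ 2 * u z) y (b i)) x (b j)) ^ 2
    with hHw
  set P1f : E → ℝ := fun x => η x ^ 2 * ∑ i, (fderiv ℝ u x (b i)) ^ 2 with hP1f
  have hFc : Continuous F := by simp only [hF]; fun_prop
  have hHwc : Continuous Hw := by simp only [hHw]; fun_prop
  have hP1c : Continuous P1f := by simp only [hP1f]; fun_prop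
  have hF0 : ∀ x ∉ tsupport η, F x = 0 := fun x hx => by simp [hF, h0 x hx]
  have hP10 : ∀ x ∉ tsupport η, P1f x = 0 := fun x hx => by simp [hP1f, h0 x hx]
  have hFS : ∫ x, F x = ∫ x in S, F x := (setIntegral_eq_integral_of_tsupport_subset hηS hF0).symm
  have hP1S : ∫ x in S, P1f x = ∫ x, P1f x := setIntegral_eq_integral_of_tsupport_subset hηS hP10
  -- integrability on `S`
  have hiF : IntegrableOn F S := hFc.continuousOn.integrableOn_compact hS
  have hiHw : IntegrableOn Hw S := hHwc.continuousOn.integrableOn_compact hS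
  have hiP1 : IntegrableOn P1f S := hP1c.continuousOn.integrableOn_compact hS
  have hiu2 : IntegrableOn (fun x => u x ^ 2) S := (hucont.pow 2).continuousOn.integrableOn_compact hS
  set n : ℝ := (Fintype.card ι : ℝ) with hn
  have hi1 : Integrable (fun x => 4 * Hw x + 32 * n * L ^ 2 * P1f x) (volume.restrict S) :=
    (hiHw.const_mul 4).add (hiP1.const_mul _)
  have hi2 : Integrable (fun x => 64 * n ^ 2 * L ^ 4 * u x ^ 2) (volume.restrict S) :=
    hiu2.const_mul _
  have hi3 : Integrable (fun x => 4 * Hw x + 32 * n * L ^ 2 * P1f x + 64 * n ^ 2 * L ^ 4 * u x ^ 2)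
      (volume.restrict S) := hi1.add hi2
  have hi4 : Integrable (fun x => 4 * Hw x) (volume.restrict S) := hiHw.const_mul 4
  have hi5 : Integrable (fun x => 32 * n * L ^ 2 * P1f x) (volume.restrict S) := hiP1.const_mul _
  have hmono : ∫ x in S, F x ≤
      ∫ x in S, (4 * Hw x + 32 * n * L ^ 2 * P1f x + 64 * n ^ 2 * L ^ 4 * u x ^ 2) :=
    setIntegral_mono_on hiF hi3 hSm fun x _ => hpt x
  have hsplit : ∫ x in S, (4 * Hw x + 32 * n * L ^ 2 * P1f x + 64 * n ^ 2 * L ^ 4 * u x ^ 2) =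
      4 * (∫ x in S, Hw x) + 32 * n * L ^ 2 * (∫ x in S, P1f x)
        + 64 * n ^ 2 * L ^ 4 * ∫ x in S, u x ^ 2 := by
    rw [integral_add hi1 hi2, integral_add hi4 hi5, integral_const_mul, integral_const_mul,
      integral_const_mul]
  -- `∫_S Hw ≤ ∫ Hw = ∫ (Δw)²`
  have hintW : ∀ i j, Integrable fun x =>
      (fderiv ℝ (fun y => fderiv ℝ (fun z => η z ^ 2 * u z) y (b i)) x (b j)) ^ 2 := by
    intro i j
    have h1 : Continuous fun x =>
        (fderiv ℝ (fun y => fderiv ℝ (fun z => η z ^ 2 * u z) y (b i)) x (b j)) ^ 2 :=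
      (hc2w i j).pow 2
    have h2 : HasCompactSupport fun x =>
        (fderiv ℝ (fun y => fderiv ℝ (fun z => η z ^ 2 * u z) y (b i)) x (b j)) ^ 2 :=
      (hasCompactSupport_fderiv_fderiv_apply hwc (b i) (b j)).comp_left (g := fun t : ℝ => t ^ 2)
        (by norm_num)
    exact h1.integrable_of_hasCompactSupport h2
  have hintWi : ∀ i, Integrable fun x =>
      ∑ j, (fderiv ℝ (fun y => fderiv ℝ (fun z => η z ^ 2 * u z) y (b i)) x (b j)) ^ 2 :=
    fun i => integrable_finsetSum _ fun j _ => hintW i j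
  have hHwint : Integrable Hw := integrable_finsetSum _ fun i _ => hintWi i
  have hHwle : ∫ x in S, Hw x ≤ ∫ x, Hw x :=
    setIntegral_le_integral hHwint (Eventually.of_forall fun x =>
      Finset.sum_nonneg fun i _ => Finset.sum_nonneg fun j _ => sq_nonneg _)
  have hHweq : ∫ x, Hw x = ∫ x, ((Δ fun y => η y ^ 2 * u y) x) ^ 2 := by
    rw [← hHS]
    simp only [hHw]
    rw [integral_finsetSum _ fun i _ => hintWi i]
    exact Finset.sum_congr rfl fun i _ => integral_finsetSum _ fun j _ => hintW i j
  have h4 : 4 * (∫ x in S, Hw x) ≤ 4 * ∫ x, ((Δ fun y => η y ^ 2 * u y) x) ^ 2 := by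
    rw [← hHweq]; linarith [hHwle]
  rw [hFS]
  calc ∫ x in S, F x ≤ _ := hmono
    _ = _ := hsplit
    _ ≤ _ := by rw [hP1S]; linarith [h4]

/-- **The Laplacian of the cut-off product in `L²`.** Under the same hypotheses (`u, η ∈ C²`),
`∫ (Δ(η²u))² ≤ 3 ∫ η⁴ (Δu)² + 48 n L² ∫ η² Σᵢ(∂ᵢu)² + 48 n² L⁴ ∫_S u²`. [folklore] -/
theorem integral_sq_laplacian_cutoff_mul_le (hu : ContDiff ℝ 2 u) (hη : ContDiff ℝ 2 η)
    (hηc : HasCompactSupport η) (hηS : tsupport η ⊆ S) (hS : IsCompact S)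
    (hη1 : ∀ x, |η x| ≤ 1) (hηL : ∀ x i, |fderiv ℝ η x (b i)| ≤ L)
    (hηL2 : ∀ x i j, |fderiv ℝ (fun y => fderiv ℝ η y (b i)) x (b j)| ≤ L ^ 2) :
    ∫ x, ((Δ fun y => η y ^ 2 * u y) x) ^ 2 ≤
      3 * (∫ x, η x ^ 4 * ((Δ u) x) ^ 2)
        + 48 * Fintype.card ι * L ^ 2 * (∫ x, η x ^ 2 * ∑ i, (fderiv ℝ u x (b i)) ^ 2)
        + 48 * (Fintype.card ι : ℝ) ^ 2 * L ^ 4 * ∫ x in S, u x ^ 2 := by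
  have hSm : MeasurableSet S := hS.isClosed.measurableSet
  have h0 : ∀ x ∉ tsupport η, η x = 0 := fun x hx => image_eq_zero_of_notMem_tsupport hx
  have hw : ContDiff ℝ 2 fun y => η y ^ 2 * u y := (hη.pow 2).mul hu
  have hwc : HasCompactSupport fun y => η y ^ 2 * u y :=
    HasCompactSupport.intro hηc fun x hx => by simp [h0 x hx]
  have hc1u : ∀ i, Continuous fun x => fderiv ℝ u x (b i) := fun i =>
    (hu.continuous_fderiv two_ne_zero).clm_apply continuous_const
  have hηcont : Continuous η := hη.continuous
  have hucont : Continuous u := hu.continuous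
  have hΔu : Continuous (Δ u) := continuous_laplacian hu
  have hΔw : Continuous (Δ fun y => η y ^ 2 * u y) := continuous_laplacian hw
  have hpt := sq_laplacian_cutoff_mul_le b hu hη hη1 hηL hηL2
  set n : ℝ := (Fintype.card ι : ℝ) with hn
  set F : E → ℝ := fun x => ((Δ fun y => η y ^ 2 * u y) x) ^ 2 with hF
  set Af : E → ℝ := fun x => η x ^ 4 * ((Δ u) x) ^ 2 with hAf
  set P1f : E → ℝ := fun x => η x ^ 2 * ∑ i, (fderiv ℝ u x (b i)) ^ 2 with hP1f
  have hFc : Continuous F := by simp only [hF]; fun_prop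
  have hAc : Continuous Af := by simp only [hAf]; fun_prop
  have hP1c : Continuous P1f := by simp only [hP1f]; fun_prop
  have hF0 : ∀ x ∉ tsupport η, F x = 0 := fun x hx => by
    have hx' : x ∉ tsupport fun y => η y ^ 2 * u y := by
      rw [notMem_tsupport_iff_eventuallyEq] at hx ⊢
      filter_upwards [hx] with y hy
      simp [hy]
    simp [hF, laplacian_eq_zero_of_notMem_tsupport hx']
  have hA0 : ∀ x ∉ tsupport η, Af x = 0 := fun x hx => by simp [hAf, h0 x hx]
  have hP10 : ∀ x ∉ tsupport η, P1f x = 0 := fun x hx => by simp [hP1f, h0 x hx]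
  have hFS : ∫ x, F x = ∫ x in S, F x := (setIntegral_eq_integral_of_tsupport_subset hηS hF0).symm
  have hAS : ∫ x in S, Af x = ∫ x, Af x := setIntegral_eq_integral_of_tsupport_subset hηS hA0
  have hP1S : ∫ x in S, P1f x = ∫ x, P1f x := setIntegral_eq_integral_of_tsupport_subset hηS hP10
  have hiF : IntegrableOn F S := hFc.continuousOn.integrableOn_compact hS
  have hiA : IntegrableOn Af S := hAc.continuousOn.integrableOn_compact hS
  have hiP1 : IntegrableOn P1f S := hP1c.continuousOn.integrableOn_compact hS
  have hiu2 : IntegrableOn (fun x => u x ^ 2) S :=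
    (hucont.pow 2).continuousOn.integrableOn_compact hS
  have hi1 : Integrable (fun x => 3 * Af x + 48 * n * L ^ 2 * P1f x) (volume.restrict S) :=
    (hiA.const_mul 3).add (hiP1.const_mul _)
  have hi2 : Integrable (fun x => 48 * n ^ 2 * L ^ 4 * u x ^ 2) (volume.restrict S) :=
    hiu2.const_mul _
  have hi3 : Integrable (fun x => 3 * Af x + 48 * n * L ^ 2 * P1f x + 48 * n ^ 2 * L ^ 4 * u x ^ 2)
      (volume.restrict S) := hi1.add hi2
  have hi4 : Integrable (fun x => 3 * Af x) (volume.restrict S) := hiA.const_mul 3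
  have hi5 : Integrable (fun x => 48 * n * L ^ 2 * P1f x) (volume.restrict S) := hiP1.const_mul _
  have hmono : ∫ x in S, F x ≤
      ∫ x in S, (3 * Af x + 48 * n * L ^ 2 * P1f x + 48 * n ^ 2 * L ^ 4 * u x ^ 2) :=
    setIntegral_mono_on hiF hi3 hSm fun x _ => hpt x
  have hsplit : ∫ x in S, (3 * Af x + 48 * n * L ^ 2 * P1f x + 48 * n ^ 2 * L ^ 4 * u x ^ 2) =
      3 * (∫ x in S, Af x) + 48 * n * L ^ 2 * (∫ x in S, P1f x)
        + 48 * n ^ 2 * L ^ 4 * ∫ x in S, u x ^ 2 := by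
    rw [integral_add hi1 hi2, integral_add hi4 hi5, integral_const_mul, integral_const_mul,
      integral_const_mul]
  rw [hFS]
  calc ∫ x in S, F x ≤ _ := hmono
    _ = _ := hsplit
    _ = _ := by rw [hAS, hP1S]

/-- **Integrating the squared Laplacian inequality.** If `|Δu| ≤ ε √(Σᵢⱼ(∂ⱼ∂ᵢu)²) +
L √(Σᵢ(∂ᵢu)²) + L² |u| + G` on `S ⊇ tsupport η`, `|η| ≤ 1`, `S` compact and `G` continuous, then
`∫ η⁴ (Δu)² ≤ 4 ε² ∫ η⁴ Σᵢⱼ(∂ⱼ∂ᵢu)² + 4 L² ∫ η² Σᵢ(∂ᵢu)² + 4 L⁴ ∫_S u² + 4 ∫_S G²`. [folklore] -/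
theorem integral_pow_four_mul_sq_laplacian_le (hu : ContDiff ℝ 2 u) (hη : Continuous η)
    (hηc : HasCompactSupport η) (hηS : tsupport η ⊆ S) (hS : IsCompact S)
    (hη1 : ∀ x, |η x| ≤ 1) (hG : Continuous G)
    (hΔ : ∀ x ∈ S, |(Δ u) x| ≤
      ε * Real.sqrt (∑ i, ∑ j, (fderiv ℝ (fun y => fderiv ℝ u y (b i)) x (b j)) ^ 2)
        + L * Real.sqrt (∑ i, (fderiv ℝ u x (b i)) ^ 2) + L ^ 2 * |u x| + G x) :
    ∫ x, η x ^ 4 * ((Δ u) x) ^ 2 ≤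
      4 * ε ^ 2 * (∫ x, η x ^ 4 * ∑ i, ∑ j, (fderiv ℝ (fun y => fderiv ℝ u y (b i)) x (b j)) ^ 2)
        + 4 * L ^ 2 * (∫ x, η x ^ 2 * ∑ i, (fderiv ℝ u x (b i)) ^ 2)
        + 4 * L ^ 4 * (∫ x in S, u x ^ 2) + 4 * ∫ x in S, G x ^ 2 := by
  have hSm : MeasurableSet S := hS.isClosed.measurableSet
  have h0 : ∀ x ∉ tsupport η, η x = 0 := fun x hx => image_eq_zero_of_notMem_tsupport hx
  have hc1u : ∀ i, Continuous fun x => fderiv ℝ u x (b i) := fun i =>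
    (hu.continuous_fderiv two_ne_zero).clm_apply continuous_const
  have hc2u : ∀ i j, Continuous fun x => fderiv ℝ (fun y => fderiv ℝ u y (b i)) x (b j) :=
    fun i j => continuous_fderiv_fderiv_apply hu (b i) (b j)
  have hucont : Continuous u := hu.continuous
  have hΔu : Continuous (Δ u) := continuous_laplacian hu
  -- the pointwise inequality holds everywhere
  set Af : E → ℝ := fun x => η x ^ 4 * ((Δ u) x) ^ 2 with hAf
  set P2f : E → ℝ := fun x =>
    η x ^ 4 * ∑ i, ∑ j, (fderiv ℝ (fun y => fderiv ℝ u y (b i)) x (b j)) ^ 2 with hP2f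
  set P1f : E → ℝ := fun x => η x ^ 2 * ∑ i, (fderiv ℝ u x (b i)) ^ 2 with hP1f
  set U2 : E → ℝ := fun x => η x ^ 2 * u x ^ 2 with hU2
  set G2 : E → ℝ := fun x => η x ^ 2 * G x ^ 2 with hG2
  have hpt : ∀ x, Af x ≤ 4 * ε ^ 2 * P2f x + 4 * L ^ 2 * P1f x + 4 * L ^ 4 * U2 x + 4 * G2 x := by
    intro x
    by_cases hx : x ∈ S
    · exact pow_four_mul_sq_laplacian_le b (hη1 x) (hΔ x hx)
    · have hx' : x ∉ tsupport η := fun h => hx (hηS h)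
      simp [hAf, hP2f, hP1f, hU2, hG2, h0 x hx']
  -- integrability (compact support)
  have hAc : Continuous Af := by simp only [hAf]; fun_prop
  have hP2c : Continuous P2f := by simp only [hP2f]; fun_prop
  have hP1c : Continuous P1f := by simp only [hP1f]; fun_prop
  have hU2c : Continuous U2 := by simp only [hU2]; fun_prop
  have hG2c : Continuous G2 := by simp only [hG2]; fun_prop
  have hiA : Integrable Af :=
    integrable_of_continuous_of_tsupport hηc hAc fun x hx => by simp [hAf, h0 x hx]
  have hiP2 : Integrable P2f :=
    integrable_of_continuous_of_tsupport hηc hP2c fun x hx => by simp [hP2f, h0 x hx]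
  have hiP1 : Integrable P1f :=
    integrable_of_continuous_of_tsupport hηc hP1c fun x hx => by simp [hP1f, h0 x hx]
  have hiU2 : Integrable U2 :=
    integrable_of_continuous_of_tsupport hηc hU2c fun x hx => by simp [hU2, h0 x hx]
  have hiG2 : Integrable G2 :=
    integrable_of_continuous_of_tsupport hηc hG2c fun x hx => by simp [hG2, h0 x hx]
  have hi1 : Integrable fun x => 4 * ε ^ 2 * P2f x + 4 * L ^ 2 * P1f x :=
    (hiP2.const_mul _).add (hiP1.const_mul _)
  have hi2 : Integrable fun x => 4 * ε ^ 2 * P2f x + 4 * L ^ 2 * P1f x + 4 * L ^ 4 * U2 x :=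
    hi1.add (hiU2.const_mul _)
  have hi3 : Integrable fun x =>
      4 * ε ^ 2 * P2f x + 4 * L ^ 2 * P1f x + 4 * L ^ 4 * U2 x + 4 * G2 x :=
    hi2.add (hiG2.const_mul _)
  have hmono := integral_mono hiA hi3 hpt
  rw [integral_add hi2 (hiG2.const_mul _), integral_add hi1 (hiU2.const_mul _),
    integral_add (hiP2.const_mul _) (hiP1.const_mul _), integral_const_mul, integral_const_mul,
    integral_const_mul, integral_const_mul] at hmono
  -- `∫ η² u² ≤ ∫_S u²` and `∫ η² G² ≤ ∫_S G²`
  have hη2 : ∀ x, η x ^ 2 ≤ 1 := fun x => by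
    have := pow_le_pow_left₀ (abs_nonneg _) (hη1 x) 2
    rwa [sq_abs, one_pow] at this
  have hU2S : ∫ x, U2 x ≤ ∫ x in S, u x ^ 2 := by
    rw [← setIntegral_eq_integral_of_tsupport_subset hηS (F := U2)
      (fun x hx => by simp [hU2, h0 x hx])]
    refine setIntegral_mono_on hiU2.integrableOn
      ((hucont.pow 2).continuousOn.integrableOn_compact hS) hSm fun x _ => ?_
    calc U2 x = η x ^ 2 * u x ^ 2 := rfl
      _ ≤ 1 * u x ^ 2 := mul_le_mul_of_nonneg_right (hη2 x) (sq_nonneg _)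
      _ = u x ^ 2 := one_mul _
  have hG2S : ∫ x, G2 x ≤ ∫ x in S, G x ^ 2 := by
    rw [← setIntegral_eq_integral_of_tsupport_subset hηS (F := G2)
      (fun x hx => by simp [hG2, h0 x hx])]
    refine setIntegral_mono_on hiG2.integrableOn
      ((hG.pow 2).continuousOn.integrableOn_compact hS) hSm fun x _ => ?_
    calc G2 x = η x ^ 2 * G x ^ 2 := rfl
      _ ≤ 1 * G x ^ 2 := mul_le_mul_of_nonneg_right (hη2 x) (sq_nonneg _)
      _ = G x ^ 2 := one_mul _
  have hL4 : 0 ≤ 4 * L ^ 4 := by positivity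
  nlinarith [hmono, mul_le_mul_of_nonneg_left hU2S hL4, hG2S]

/-- **Interior `L²` estimates for the first and second derivatives** (Caccioppoli and
Hessian energies with a cut-off). Let `u, η ∈ C³(E)` with `η` supported in the compact set `S`,
`|η| ≤ 1`, `|∂ᵢη| ≤ L`, `|∂ⱼ∂ᵢη| ≤ L²` (`L > 0`), and suppose that on `S`
`|Δu| ≤ ε √(Σᵢⱼ(∂ⱼ∂ᵢu)²) + L √(Σᵢ(∂ᵢu)²) + L² |u| + G` with `0 ≤ ε ≤ 1/10` and `G` continuous.
Then, with `n = dim`,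
`∫ η² Σᵢ(∂ᵢu)² ≤ 400 (n+1)² L² ∫_S u² + 3 L⁻² ∫_S G²` and
`∫ η⁴ Σᵢⱼ(∂ⱼ∂ᵢu)² ≤ 220000 (n+1)³ L⁴ ∫_S u² + 1800 (n+1) ∫_S G²`, and for the cut-off
product `w = η²u`, `∫ (Δw)² ≤ 46000 (n+1)³ L⁴ ∫_S u² + 400 (n+1) ∫_S G²`.
(For `η = 1` on a ball `B_{σ/2}` inside `S = B̄_σ` and `L ≍ σ⁻¹` these are the scaled interior
`H¹` and `H²` estimates for solutions of uniformly elliptic equations close to the Laplacian;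
elementary for `C³` functions: two integrations by parts and the identity
`Σᵢⱼ ∫ (∂ⱼ∂ᵢw)² = ∫ (Δw)²` for `w = η²u`.)
[cite: GilbargTrudinger2001, Thm. 8.8 and Thm. 9.11 (proofs, case p = 2)] -/
theorem cutoff_energy_estimates (hu : ContDiff ℝ 3 u) (hη : ContDiff ℝ 3 η)
    (hηc : HasCompactSupport η) (hηS : tsupport η ⊆ S) (hS : IsCompact S)
    (hη1 : ∀ x, |η x| ≤ 1) (hηL : ∀ x i, |fderiv ℝ η x (b i)| ≤ L)
    (hηL2 : ∀ x i j, |fderiv ℝ (fun y => fderiv ℝ η y (b i)) x (b j)| ≤ L ^ 2) (hL : 0 < L)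
    (hε0 : 0 ≤ ε) (hε : ε ≤ 1 / 10) (hG : Continuous G)
    (hΔ : ∀ x ∈ S, |(Δ u) x| ≤
      ε * Real.sqrt (∑ i, ∑ j, (fderiv ℝ (fun y => fderiv ℝ u y (b i)) x (b j)) ^ 2)
        + L * Real.sqrt (∑ i, (fderiv ℝ u x (b i)) ^ 2) + L ^ 2 * |u x| + G x) :
    (∫ x, η x ^ 2 * ∑ i, (fderiv ℝ u x (b i)) ^ 2) ≤
        400 * ((Fintype.card ι : ℝ) + 1) ^ 2 * L ^ 2 * (∫ x in S, u x ^ 2)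
          + 3 * (∫ x in S, G x ^ 2) / L ^ 2 ∧
      (∫ x, η x ^ 4 * ∑ i, ∑ j, (fderiv ℝ (fun y => fderiv ℝ u y (b i)) x (b j)) ^ 2) ≤
        220000 * ((Fintype.card ι : ℝ) + 1) ^ 3 * L ^ 4 * (∫ x in S, u x ^ 2)
          + 1800 * ((Fintype.card ι : ℝ) + 1) * ∫ x in S, G x ^ 2 ∧
      (∫ x, ((Δ fun y => η y ^ 2 * u y) x) ^ 2) ≤
        46000 * ((Fintype.card ι : ℝ) + 1) ^ 3 * L ^ 4 * (∫ x in S, u x ^ 2)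
          + 400 * ((Fintype.card ι : ℝ) + 1) * ∫ x in S, G x ^ 2 := by
  have hu2 : ContDiff ℝ 2 u := hu.of_le (by norm_num)
  have hη2 : ContDiff ℝ 2 η := hη.of_le (by norm_num)
  have hη1' : ContDiff ℝ 1 η := hη.of_le (by norm_num)
  have hSm : MeasurableSet S := hS.isClosed.measurableSet
  have h0 : ∀ x ∉ tsupport η, η x = 0 := fun x hx => image_eq_zero_of_notMem_tsupport hx
  have h0' : ∀ x ∉ tsupport η, ∀ v, fderiv ℝ η x v = 0 := fun x hx v =>
    (eq_zero_of_notMem_tsupport_cutoff hx v v).2.1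
  have hc1u : ∀ i, Continuous fun x => fderiv ℝ u x (b i) := fun i =>
    (hu2.continuous_fderiv two_ne_zero).clm_apply continuous_const
  have hc2u : ∀ i j, Continuous fun x => fderiv ℝ (fun y => fderiv ℝ u y (b i)) x (b j) :=
    fun i j => continuous_fderiv_fderiv_apply hu2 (b i) (b j)
  have hc1η : ∀ i, Continuous fun x => fderiv ℝ η x (b i) := fun i =>
    (hη1'.continuous_fderiv one_ne_zero).clm_apply continuous_const
  have hucont : Continuous u := hu.continuous
  have hηcont : Continuous η := hη.continuous
  have hΔu : Continuous (Δ u) := continuous_laplacian hu2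
  set n : ℝ := (Fintype.card ι : ℝ) with hn
  set P0 : ℝ := ∫ x in S, u x ^ 2 with hP0
  set P1 : ℝ := ∫ x, η x ^ 2 * ∑ i, (fderiv ℝ u x (b i)) ^ 2 with hP1
  set P2 : ℝ := ∫ x, η x ^ 4 * ∑ i, ∑ j, (fderiv ℝ (fun y => fderiv ℝ u y (b i)) x (b j)) ^ 2
    with hP2
  set Γ : ℝ := ∫ x in S, G x ^ 2 with hΓ
  set W : ℝ := ∫ x, ((Δ fun y => η y ^ 2 * u y) x) ^ 2 with hW
  set A : ℝ := ∫ x, η x ^ 4 * ((Δ u) x) ^ 2 with hA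
  set T : ℝ := 2 * ∫ x, η x ^ 2 * |u x| * |(Δ u) x| with hT
  -- the three integral inequalities already proved
  have h3 : P2 ≤ 4 * W + 32 * n * L ^ 2 * P1 + 64 * n ^ 2 * L ^ 4 * P0 :=
    integral_pow_four_mul_sum_sq_fderiv_fderiv_le b hu hη hηc hηS hS hη1 hηL hηL2
  have h4 : W ≤ 3 * A + 48 * n * L ^ 2 * P1 + 48 * n ^ 2 * L ^ 4 * P0 :=
    integral_sq_laplacian_cutoff_mul_le b hu2 hη2 hηc hηS hS hη1 hηL hηL2
  have h5 : A ≤ 4 * ε ^ 2 * P2 + 4 * L ^ 2 * P1 + 4 * L ^ 4 * P0 + 4 * Γ :=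
    integral_pow_four_mul_sq_laplacian_le b hu2 hηcont hηc hηS hS hη1 hG hΔ
  -- nonnegativity
  have hP0n : 0 ≤ P0 := setIntegral_nonneg hSm fun x _ => sq_nonneg _
  have hP1n : 0 ≤ P1 := integral_nonneg fun x => mul_nonneg (sq_nonneg _)
    (Finset.sum_nonneg fun i _ => sq_nonneg _)
  have hP2n : 0 ≤ P2 := integral_nonneg fun x => mul_nonneg (by positivity)
    (Finset.sum_nonneg fun i _ => Finset.sum_nonneg fun j _ => sq_nonneg _)
  have hΓn : 0 ≤ Γ := setIntegral_nonneg hSm fun x _ => sq_nonneg _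
  -- Caccioppoli: `P1 ≤ T + 4 n L² P0`
  have hC : P1 ≤ T + 4 * n * L ^ 2 * P0 := by
    have hcac := integral_cutoff_sq_mul_sum_sq_fderiv_le b hu2 hη1' hηc
    have hY : ∫ x, u x ^ 2 * ∑ i, (fderiv ℝ η x (b i)) ^ 2 ≤ n * L ^ 2 * P0 := by
      rw [← setIntegral_eq_integral_of_tsupport_subset hηS
        (F := fun x => u x ^ 2 * ∑ i, (fderiv ℝ η x (b i)) ^ 2)
        (fun x hx => by simp [h0' x hx]), hP0, ← integral_const_mul]
      refine setIntegral_mono_on ?_ ?_ hSm fun x _ => ?_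
      · exact (by fun_prop : Continuous fun x => u x ^ 2 * ∑ i, (fderiv ℝ η x (b i)) ^ 2)
          |>.continuousOn.integrableOn_compact hS
      · exact ((hucont.pow 2).const_mul _).continuousOn.integrableOn_compact hS
      · have hsum : ∑ i, (fderiv ℝ η x (b i)) ^ 2 ≤ n * L ^ 2 := by
          calc ∑ i, (fderiv ℝ η x (b i)) ^ 2 ≤ ∑ _i : ι, L ^ 2 :=
                Finset.sum_le_sum fun i _ => by
                  rw [← sq_abs]; exact pow_le_pow_left₀ (abs_nonneg _) (hηL x i) 2
            _ = n * L ^ 2 := by rw [Finset.sum_const, nsmul_eq_mul, Finset.card_univ]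
        calc u x ^ 2 * ∑ i, (fderiv ℝ η x (b i)) ^ 2 ≤ u x ^ 2 * (n * L ^ 2) :=
              mul_le_mul_of_nonneg_left hsum (sq_nonneg _)
          _ = n * L ^ 2 * u x ^ 2 := by ring
    linarith [hcac, hY]
  -- the right-hand side of Caccioppoli: `T ≤ …`
  set κ : ℝ := 4 * (96 + 448 * n) with hκ
  have hn0 : 0 ≤ n := by rw [hn]; exact Nat.cast_nonneg _
  have hκ0 : 0 < κ := by rw [hκ]; positivity
  have hTb : T ≤ (ε * κ + 7) * L ^ 2 * P0 + ε / (κ * L ^ 2) * P2 + P1 / 4 + Γ / L ^ 2 := by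
    set Tf : E → ℝ := fun x => 2 * (η x ^ 2 * |u x| * |(Δ u) x|) with hTf
    set P2f : E → ℝ := fun x =>
      η x ^ 4 * ∑ i, ∑ j, (fderiv ℝ (fun y => fderiv ℝ u y (b i)) x (b j)) ^ 2 with hP2f
    set P1f : E → ℝ := fun x => η x ^ 2 * ∑ i, (fderiv ℝ u x (b i)) ^ 2 with hP1f
    set G2 : E → ℝ := fun x => η x ^ 2 * G x ^ 2 with hG2
    set R : E → ℝ := fun x => (ε * κ + 7) * L ^ 2 * u x ^ 2 + ε / (κ * L ^ 2) * P2f x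
      + P1f x / 4 + G2 x / L ^ 2 with hR
    have hpt : ∀ x ∈ S, Tf x ≤ R x := fun x hx =>
      two_mul_cutoff_sq_mul_abs_mul_abs_laplacian_le b hκ0 hL hε0 (hη1 x) (hΔ x hx)
    have hTfc : Continuous Tf := by simp only [hTf]; fun_prop
    have hP2c : Continuous P2f := by simp only [hP2f]; fun_prop
    have hP1c : Continuous P1f := by simp only [hP1f]; fun_prop
    have hG2c : Continuous G2 := by simp only [hG2]; fun_prop
    have hRc : Continuous R := by simp only [hR]; fun_prop
    have hTeq : T = ∫ x in S, Tf x := by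
      rw [hT, ← integral_const_mul, setIntegral_eq_integral_of_tsupport_subset hηS
        (fun x hx => by simp [hTf, h0 x hx])]
    have hmono : ∫ x in S, Tf x ≤ ∫ x in S, R x :=
      setIntegral_mono_on (hTfc.continuousOn.integrableOn_compact hS)
        (hRc.continuousOn.integrableOn_compact hS) hSm hpt
    -- split `∫_S R`
    have hiu : IntegrableOn (fun x => (ε * κ + 7) * L ^ 2 * u x ^ 2) S :=
      (((hucont.pow 2).const_mul _).continuousOn.integrableOn_compact hS)
    have hiP2 : IntegrableOn (fun x => ε / (κ * L ^ 2) * P2f x) S :=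
      ((hP2c.const_mul _).continuousOn.integrableOn_compact hS)
    have hiP1 : IntegrableOn (fun x => P1f x / 4) S :=
      ((hP1c.div_const _).continuousOn.integrableOn_compact hS)
    have hiG2 : IntegrableOn (fun x => G2 x / L ^ 2) S :=
      ((hG2c.div_const _).continuousOn.integrableOn_compact hS)
    have hi12 : Integrable (fun x => (ε * κ + 7) * L ^ 2 * u x ^ 2 + ε / (κ * L ^ 2) * P2f x)
        (volume.restrict S) := hiu.add hiP2
    have hi123 : Integrable (fun x => (ε * κ + 7) * L ^ 2 * u x ^ 2 + ε / (κ * L ^ 2) * P2f x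
        + P1f x / 4) (volume.restrict S) := hi12.add hiP1
    have hsplit : ∫ x in S, R x = (ε * κ + 7) * L ^ 2 * P0 + ε / (κ * L ^ 2) * (∫ x in S, P2f x)
        + (∫ x in S, P1f x) / 4 + (∫ x in S, G2 x) / L ^ 2 := by
      simp only [hR]
      rw [integral_add hi123 hiG2, integral_add hi12 hiP1, integral_add hiu hiP2,
        integral_const_mul, integral_const_mul, integral_div, integral_div]
    have hP2S : ∫ x in S, P2f x = P2 :=
      setIntegral_eq_integral_of_tsupport_subset hηS (fun x hx => by simp [hP2f, h0 x hx])
    have hP1S : ∫ x in S, P1f x = P1 :=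
      setIntegral_eq_integral_of_tsupport_subset hηS (fun x hx => by simp [hP1f, h0 x hx])
    have hη2 : ∀ x, η x ^ 2 ≤ 1 := fun x => by
      have := pow_le_pow_left₀ (abs_nonneg _) (hη1 x) 2
      rwa [sq_abs, one_pow] at this
    have hG2S : ∫ x in S, G2 x ≤ Γ := by
      refine setIntegral_mono_on (hG2c.continuousOn.integrableOn_compact hS)
        ((hG.pow 2).continuousOn.integrableOn_compact hS) hSm fun x _ => ?_
      calc G2 x = η x ^ 2 * G x ^ 2 := rfl
        _ ≤ 1 * G x ^ 2 := mul_le_mul_of_nonneg_right (hη2 x) (sq_nonneg _)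
        _ = G x ^ 2 := one_mul _
    have hL2 : 0 < L ^ 2 := by positivity
    have hdiv : (∫ x in S, G2 x) / L ^ 2 ≤ Γ / L ^ 2 := div_le_div_of_nonneg_right hG2S hL2.le
    rw [hP2S, hP1S] at hsplit
    rw [hTeq]
    linarith [hmono, hsplit, hdiv]
  exact energy_bookkeeping hn0 hε0 hε hL hP0n hP1n hP2n hΓn h3 h4 h5 hC hTb

end Energy

/-! ### Cut-off functions at scale `σ` -/

section Cutoff

variable [FiniteDimensional ℝ E] {ι : Type*} [Fintype ι] (b : OrthonormalBasis ι ℝ E)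

/-- **Cut-off functions at every scale with the natural derivative bounds.** There is `M ≥ 1`
(depending only on `E`) such that for every centre `x₀` and radius `σ > 0` there is a smooth
`η` with `η = 1` on `B̄(x₀, σ/2)`, `tsupport η ⊆ B̄(x₀, σ)`, `0 ≤ η ≤ 1`, `|∂ᵢη| ≤ M/σ` and
`|∂ⱼ∂ᵢη| ≤ (M/σ)²` (rescaling `η(y) = φ((y - x₀)/(σ/2))` of one fixed bump `φ`). [folklore] -/
theorem exists_cutoff_scale :
    ∃ M : ℝ, 1 ≤ M ∧ ∀ (x₀ : E) (σ : ℝ), 0 < σ → ∃ η : E → ℝ,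
      ContDiff ℝ ∞ η ∧ HasCompactSupport η ∧ tsupport η ⊆ closedBall x₀ σ ∧
      (∀ y ∈ closedBall x₀ (σ / 2), η y = 1) ∧ (∀ y, |η y| ≤ 1) ∧
      (∀ y i, |fderiv ℝ η y (b i)| ≤ M / σ) ∧
      (∀ y i j, |fderiv ℝ (fun z => fderiv ℝ η z (b i)) y (b j)| ≤ (M / σ) ^ 2) := by
  -- one fixed bump `φ = 1` on `B̄(0,1)`, supported in `B̄(0,2)`
  set φ : ContDiffBump (0 : E) := ⟨1, 2, one_pos, one_lt_two⟩ with hφ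
  have hφs : ContDiff ℝ ∞ (φ : E → ℝ) := φ.contDiff
  have hφc : HasCompactSupport (φ : E → ℝ) := φ.hasCompactSupport
  have hφ2 : ContDiff ℝ 2 (φ : E → ℝ) := hφs.of_le (WithTop.coe_le_coe.mpr le_top)
  -- bounds for the first two derivatives of `φ`
  have hD1c : Continuous (fderiv ℝ (φ : E → ℝ)) := hφs.continuous_fderiv (by simp)
  have hD1s : HasCompactSupport (fderiv ℝ (φ : E → ℝ)) := hφc.fderiv ℝ
  obtain ⟨M₁, hM₁⟩ := hD1s.exists_bound_of_continuous hD1c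
  have hD1d : ContDiff ℝ ∞ (fderiv ℝ (φ : E → ℝ)) := hφs.fderiv_right (m := ∞) (by simp)
  have hD2c : Continuous (fderiv ℝ (fderiv ℝ (φ : E → ℝ))) := hD1d.continuous_fderiv (by simp)
  have hD2s : HasCompactSupport (fderiv ℝ (fderiv ℝ (φ : E → ℝ))) := hD1s.fderiv ℝ
  obtain ⟨M₂, hM₂⟩ := hD2s.exists_bound_of_continuous hD2c
  have hM₁0 : 0 ≤ M₁ := (norm_nonneg _).trans (hM₁ 0)
  have hM₂0 : 0 ≤ M₂ := (norm_nonneg _).trans (hM₂ 0)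
  set M : ℝ := 2 * M₁ + 4 * M₂ + 1 with hM
  have hM1 : 1 ≤ M := by rw [hM]; linarith
  have hMa : 2 * M₁ ≤ M := by rw [hM]; linarith
  have hMb : 4 * M₂ ≤ M ^ 2 := by nlinarith
  refine ⟨M, hM1, fun x₀ σ hσ => ?_⟩
  set s : ℝ := σ / 2 with hs
  have hs0 : 0 < s := by rw [hs]; positivity
  -- the affine rescaling `A y = s⁻¹ (y - x₀)`
  set A : E → E := fun y => s⁻¹ • (y - x₀) with hA
  have hAd : ∀ y, HasFDerivAt A (s⁻¹ • ContinuousLinearMap.id ℝ E) y := fun y => by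
    have h := ((hasFDerivAt_id (𝕜 := ℝ) y).sub_const x₀).const_smul s⁻¹
    exact h
  have hAs : ContDiff ℝ ∞ A := (contDiff_id.sub contDiff_const).const_smul _
  set η : E → ℝ := fun y => φ (A y) with hη
  have hηs : ContDiff ℝ ∞ η := hφs.comp hAs
  -- first derivative: `∂ᵥη(y) = s⁻¹ ∂ᵥφ(A y)`
  have hφd : ∀ z, DifferentiableAt ℝ (φ : E → ℝ) z := fun z =>
    hφ2.differentiable two_ne_zero z
  have hdη : ∀ y v, fderiv ℝ η y v = s⁻¹ * fderiv ℝ (φ : E → ℝ) (A y) v := by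
    intro y v
    have h := ((hφd (A y)).hasFDerivAt.comp y (hAd y)).fderiv
    rw [show η = (φ : E → ℝ) ∘ A from rfl, h]
    simp [smul_eq_mul]
  -- second derivative: `∂_w∂ᵥη(y) = s⁻² ∂_w∂ᵥφ(A y)`
  have hD1one : ContDiff ℝ 1 (fderiv ℝ (φ : E → ℝ)) := hD1d.of_le (WithTop.coe_le_coe.mpr le_top)
  have hψd : ∀ v z, DifferentiableAt ℝ (fun w => fderiv ℝ (φ : E → ℝ) w v) z := fun v z =>
    (hD1one.differentiable one_ne_zero z).clm_apply (differentiableAt_const v)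
  have hd2η : ∀ y v w, fderiv ℝ (fun z => fderiv ℝ η z v) y w =
      s⁻¹ * (s⁻¹ * fderiv ℝ (fun z => fderiv ℝ (φ : E → ℝ) z v) (A y) w) := by
    intro y v w
    have e1 : (fun z => fderiv ℝ η z v) =
        fun z => s⁻¹ * ((fun u => fderiv ℝ (φ : E → ℝ) u v) ∘ A) z :=
      funext fun z => hdη z v
    have h2 : HasFDerivAt (fun z => s⁻¹ * ((fun u => fderiv ℝ (φ : E → ℝ) u v) ∘ A) z)
        (s⁻¹ • ((fderiv ℝ (fun u => fderiv ℝ (φ : E → ℝ) u v) (A y)).comp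
          (s⁻¹ • ContinuousLinearMap.id ℝ E))) y :=
      ((hψd v (A y)).hasFDerivAt.comp y (hAd y)).const_mul s⁻¹
    rw [e1, h2.fderiv]
    simp only [FunLike.coe_smul, Pi.smul_apply, ContinuousLinearMap.comp_apply,
      ContinuousLinearMap.id_apply, map_smul, smul_eq_mul]
  have hD1diff : ∀ z, DifferentiableAt ℝ (fderiv ℝ (φ : E → ℝ)) z := fun z =>
    hD1one.differentiable one_ne_zero z
  have hd2φ : ∀ z v w, fderiv ℝ (fun u => fderiv ℝ (φ : E → ℝ) u v) z w =
      fderiv ℝ (fderiv ℝ (φ : E → ℝ)) z w v := fun z v w =>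
    fderiv_apply_const_apply (hD1diff z) v w
  -- support and values
  have hA_norm : ∀ y, ‖A y‖ = ‖y - x₀‖ / s := fun y => by
    rw [hA]
    simp only [norm_smul, norm_inv, Real.norm_eq_abs, abs_of_pos hs0]
    rw [div_eq_inv_mul]
  have hone : ∀ y ∈ closedBall x₀ (σ / 2), η y = 1 := by
    intro y hy
    apply φ.one_of_mem_closedBall
    rw [mem_closedBall, dist_zero_right, hA_norm, div_le_one hs0]
    rwa [mem_closedBall, dist_eq_norm] at hy
  have hsupp : tsupport η ⊆ closedBall x₀ σ := by
    refine closure_minimal (fun y hy => ?_) isClosed_closedBall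
    have hy' : A y ∈ Function.support (φ : E → ℝ) := hy
    rw [φ.support_eq, mem_ball, dist_zero_right, hA_norm] at hy'
    rw [mem_closedBall, dist_eq_norm]
    have : ‖y - x₀‖ < (2 : ℝ) * s := by
      have h := hy'
      rw [div_lt_iff₀ hs0] at h
      simpa [hφ] using h
    rw [hs] at this
    linarith
  have hηc : HasCompactSupport η :=
    IsCompact.of_isClosed_subset (isCompact_closedBall x₀ σ) (isClosed_tsupport η) hsupp
  have habs : ∀ y, |η y| ≤ 1 := fun y => by
    rw [abs_of_nonneg (φ.nonneg' _)]
    exact φ.le_one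
  refine ⟨η, hηs, hηc, hsupp, hone, habs, fun y i => ?_, fun y i j => ?_⟩
  · rw [hdη, abs_mul, abs_inv, abs_of_pos hs0]
    have h1 : |fderiv ℝ (φ : E → ℝ) (A y) (b i)| ≤ M₁ := by
      calc |fderiv ℝ (φ : E → ℝ) (A y) (b i)| = ‖fderiv ℝ (φ : E → ℝ) (A y) (b i)‖ :=
            (Real.norm_eq_abs _).symm
        _ ≤ ‖fderiv ℝ (φ : E → ℝ) (A y)‖ * ‖b i‖ := ContinuousLinearMap.le_opNorm _ _
        _ ≤ M₁ * 1 := by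
            rw [b.orthonormal.1 i]
            exact mul_le_mul_of_nonneg_right (hM₁ _) zero_le_one
        _ = M₁ := mul_one _
    calc s⁻¹ * |fderiv ℝ (φ : E → ℝ) (A y) (b i)| ≤ s⁻¹ * M₁ :=
          mul_le_mul_of_nonneg_left h1 (inv_nonneg.2 hs0.le)
      _ = 2 * M₁ / σ := by rw [hs]; field_simp
      _ ≤ M / σ := div_le_div_of_nonneg_right hMa hσ.le
  · rw [hd2η, hd2φ, abs_mul, abs_mul, abs_inv, abs_of_pos hs0]
    have h1 : |fderiv ℝ (fderiv ℝ (φ : E → ℝ)) (A y) (b j) (b i)| ≤ M₂ := by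
      calc |fderiv ℝ (fderiv ℝ (φ : E → ℝ)) (A y) (b j) (b i)|
          = ‖fderiv ℝ (fderiv ℝ (φ : E → ℝ)) (A y) (b j) (b i)‖ := (Real.norm_eq_abs _).symm
        _ ≤ ‖fderiv ℝ (fderiv ℝ (φ : E → ℝ)) (A y) (b j)‖ * ‖b i‖ :=
            ContinuousLinearMap.le_opNorm _ _
        _ ≤ ‖fderiv ℝ (fderiv ℝ (φ : E → ℝ)) (A y)‖ * ‖b j‖ * ‖b i‖ :=
            mul_le_mul_of_nonneg_right (ContinuousLinearMap.le_opNorm _ _) (norm_nonneg _)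
        _ ≤ M₂ * 1 * 1 := by
            rw [b.orthonormal.1 i, b.orthonormal.1 j]
            exact mul_le_mul_of_nonneg_right
              (mul_le_mul_of_nonneg_right (hM₂ _) zero_le_one) zero_le_one
        _ = M₂ := by ring
    calc s⁻¹ * (s⁻¹ * |fderiv ℝ (fderiv ℝ (φ : E → ℝ)) (A y) (b j) (b i)|)
        ≤ s⁻¹ * (s⁻¹ * M₂) :=
          mul_le_mul_of_nonneg_left (mul_le_mul_of_nonneg_left h1 (inv_nonneg.2 hs0.le))
            (inv_nonneg.2 hs0.le)
      _ = 4 * M₂ / σ ^ 2 := by rw [hs]; field_simp; ring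
      _ ≤ M ^ 2 / σ ^ 2 := div_le_div_of_nonneg_right hMb (by positivity)
      _ = (M / σ) ^ 2 := by rw [div_pow]

/-- **Globalisation of a function smooth on an open neighbourhood of a closed ball**: if
`u ∈ Cᴺ(U)`, `U` open, `B̄(x₀, σ) ⊆ U`, there is `v ∈ Cᴺ(E)` agreeing with `u` on a larger open
ball `B(x₀, σ + δ)` (`v = θu` for a bump `θ = 1` near the closed ball with `tsupport θ ⊆ U`).
[folklore] -/
theorem exists_contDiff_eqOn_ball {U : Set E} (hU : IsOpen U) {x₀ : E} {σ : ℝ} (hσ : 0 < σ)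
    (hK : closedBall x₀ σ ⊆ U) {u : E → ℝ} {N : ℕ∞} (hu : ContDiffOn ℝ N u U) :
    ∃ v : E → ℝ, ContDiff ℝ N v ∧ ∃ δ : ℝ, 0 < δ ∧ EqOn v u (ball x₀ (σ + δ)) := by
  obtain ⟨δ, hδ, hδU⟩ := (isCompact_closedBall x₀ σ).exists_thickening_subset_open hU hK
  rw [thickening_closedBall hδ hσ.le] at hδU
  set θ : ContDiffBump x₀ := ⟨σ + δ / 4, σ + δ / 2, by positivity, by linarith⟩ with hθ
  have hθU : tsupport (θ : E → ℝ) ⊆ U := by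
    rw [θ.tsupport_eq]
    exact (closedBall_subset_ball (by simp [hθ]; linarith)).trans hδU
  refine ⟨fun y => θ y * u y, ?_, δ / 4, by positivity, fun y hy => ?_⟩
  · refine contDiff_iff_contDiffAt.2 fun y => ?_
    by_cases hy : y ∈ U
    · exact (θ.contDiffAt (n := N)).mul (hu.contDiffAt (hU.mem_nhds hy))
    · have hy' : y ∉ tsupport (θ : E → ℝ) := fun h => hy (hθU h)
      have hev : (fun z => θ z * u z) =ᶠ[𝓝 y] fun _ => 0 := by
        filter_upwards [notMem_tsupport_iff_eventuallyEq.1 hy'] with z hz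
        rw [hz, Pi.zero_apply, zero_mul]
      exact contDiffAt_const.congr_of_eventuallyEq hev
  · have h1 : θ y = 1 := θ.one_of_mem_closedBall (ball_subset_closedBall (by simpa [hθ] using hy))
    simp [h1]

variable [MeasurableSpace E] [BorelSpace E]

/-- **Interior `L²` estimates on concentric balls.** There is `M ≥ 1` (depending only on `E`)
with the following property. Let `U` be open, `B̄(x₀, σ) ⊆ U` (`σ > 0`), `u ∈ C³(U)`, `G`
continuous, `0 ≤ ε ≤ 1/10`, and suppose that on `B̄(x₀, σ)`
`|Δu| ≤ ε √(Σᵢⱼ(∂ⱼ∂ᵢu)²) + (M/σ) √(Σᵢ(∂ᵢu)²) + (M/σ)² |u| + G`. Then, with `n = dim` and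
`L = M/σ`,
`∫_{B(x₀,σ/2)} Σᵢ(∂ᵢu)² ≤ 400 (n+1)² L² ∫_{B̄(x₀,σ)} u² + 3 L⁻² ∫_{B̄(x₀,σ)} G²`,
`∫_{B(x₀,σ/2)} Σᵢⱼ(∂ⱼ∂ᵢu)² ≤ 220000 (n+1)³ L⁴ ∫_{B̄(x₀,σ)} u² + 1800 (n+1) ∫_{B̄(x₀,σ)} G²`,
and there is `w ∈ C³_c` with `tsupport w ⊆ B̄(x₀, σ)`, `w = u` on `B̄(x₀, σ/2)` and
`∫ (Δw)² ≤ 46000 (n+1)³ L⁴ ∫_{B̄(x₀,σ)} u² + 400 (n+1) ∫_{B̄(x₀,σ)} G²` (the scaled interior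
`H¹`/`H²` estimates for classical solutions of uniformly elliptic equations close to the
Laplacian). [cite: GilbargTrudinger2001, Thm. 8.8 and Thm. 9.11 (proofs, case p = 2)] -/
theorem ball_energy_estimates :
    ∃ M : ℝ, 1 ≤ M ∧ ∀ (U : Set E) (u G : E → ℝ) (x₀ : E) (σ ε : ℝ),
      IsOpen U → closedBall x₀ σ ⊆ U → ContDiffOn ℝ 3 u U → 0 < σ → 0 ≤ ε → ε ≤ 1 / 10 →
      Continuous G →
      (∀ x ∈ closedBall x₀ σ, |(Δ u) x| ≤
        ε * Real.sqrt (∑ i, ∑ j, (fderiv ℝ (fun y => fderiv ℝ u y (b i)) x (b j)) ^ 2)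
          + M / σ * Real.sqrt (∑ i, (fderiv ℝ u x (b i)) ^ 2) + (M / σ) ^ 2 * |u x| + G x) →
      (∫ x in ball x₀ (σ / 2), ∑ i, (fderiv ℝ u x (b i)) ^ 2) ≤
          400 * ((Fintype.card ι : ℝ) + 1) ^ 2 * (M / σ) ^ 2 * (∫ x in closedBall x₀ σ, u x ^ 2)
            + 3 * (∫ x in closedBall x₀ σ, G x ^ 2) / (M / σ) ^ 2 ∧
        (∫ x in ball x₀ (σ / 2), ∑ i, ∑ j, (fderiv ℝ (fun y => fderiv ℝ u y (b i)) x (b j)) ^ 2) ≤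
          220000 * ((Fintype.card ι : ℝ) + 1) ^ 3 * (M / σ) ^ 4
              * (∫ x in closedBall x₀ σ, u x ^ 2)
            + 1800 * ((Fintype.card ι : ℝ) + 1) * ∫ x in closedBall x₀ σ, G x ^ 2 ∧
        ∃ w : E → ℝ, ContDiff ℝ 3 w ∧ HasCompactSupport w ∧ tsupport w ⊆ closedBall x₀ σ ∧
          (∀ x ∈ closedBall x₀ (σ / 2), w x = u x) ∧
          (∫ x, ((Δ w) x) ^ 2) ≤
            46000 * ((Fintype.card ι : ℝ) + 1) ^ 3 * (M / σ) ^ 4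
                * (∫ x in closedBall x₀ σ, u x ^ 2)
              + 400 * ((Fintype.card ι : ℝ) + 1) * ∫ x in closedBall x₀ σ, G x ^ 2 := by
  obtain ⟨M, hM1, hcut⟩ := exists_cutoff_scale b
  refine ⟨M, hM1, fun U u G x₀ σ ε hU hKU hu hσ hε0 hε hG hΔ => ?_⟩
  obtain ⟨η, hηs, hηc, hηS, hη1, hηabs, hηL, hηL2⟩ := hcut x₀ σ hσ
  obtain ⟨v, hv, δ, hδ, hvu⟩ := exists_contDiff_eqOn_ball hU hσ hKU hu
  have hL : 0 < M / σ := div_pos (by linarith) hσ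
  have hS : IsCompact (closedBall x₀ σ) := isCompact_closedBall x₀ σ
  have hη3 : ContDiff ℝ 3 η := hηs.of_le (WithTop.coe_le_coe.mpr le_top)
  -- `v` agrees with `u` to all orders on the closed ball
  have hnhds : ∀ x ∈ closedBall x₀ σ, v =ᶠ[𝓝 x] u := fun x hx =>
    Filter.eventuallyEq_of_mem (isOpen_ball.mem_nhds (closedBall_subset_ball (by linarith) hx)) hvu
  have hD1 : ∀ x ∈ closedBall x₀ σ, ∀ w, fderiv ℝ v x w = fderiv ℝ u x w := fun x hx w => by
    rw [(hnhds x hx).fderiv_eq]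
  have hD1ev : ∀ x ∈ closedBall x₀ σ, ∀ w,
      (fun y => fderiv ℝ v y w) =ᶠ[𝓝 x] fun y => fderiv ℝ u y w := fun x hx w =>
    ((hnhds x hx).fderiv (𝕜 := ℝ)).mono fun y hy => by
      show fderiv ℝ v y w = fderiv ℝ u y w
      rw [hy]
  have hD2 : ∀ x ∈ closedBall x₀ σ, ∀ w w',
      fderiv ℝ (fun y => fderiv ℝ v y w) x w' = fderiv ℝ (fun y => fderiv ℝ u y w) x w' :=
    fun x hx w w' => by rw [(hD1ev x hx w).fderiv_eq]
  have hΔeq : ∀ x ∈ closedBall x₀ σ, (Δ v) x = (Δ u) x := fun x hx =>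
    (laplacian_congr_nhds (hnhds x hx)).self_of_nhds
  have hveq : ∀ x ∈ closedBall x₀ σ, v x = u x := fun x hx => (hnhds x hx).self_of_nhds
  -- the Laplacian inequality for `v`
  have hΔv : ∀ x ∈ closedBall x₀ σ, |(Δ v) x| ≤
      ε * Real.sqrt (∑ i, ∑ j, (fderiv ℝ (fun y => fderiv ℝ v y (b i)) x (b j)) ^ 2)
        + M / σ * Real.sqrt (∑ i, (fderiv ℝ v x (b i)) ^ 2) + (M / σ) ^ 2 * |v x| + G x := by
    intro x hx
    have h := hΔ x hx
    simp only [hΔeq x hx, hD2 x hx, hD1 x hx, hveq x hx]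
    exact h
  have hmain := cutoff_energy_estimates b hv hη3 hηc hηS hS hηabs hηL hηL2 hL hε0 hε hG hΔv
  obtain ⟨h1, h2, h3⟩ := hmain
  -- `∫_{B̄} v² = ∫_{B̄} u²`
  have hP0 : ∫ x in closedBall x₀ σ, v x ^ 2 = ∫ x in closedBall x₀ σ, u x ^ 2 :=
    setIntegral_congr_fun measurableSet_closedBall fun x hx => by rw [hveq x hx]
  rw [hP0] at h1 h2 h3
  -- continuity facts for `v`
  have hv2 : ContDiff ℝ 2 v := hv.of_le (by norm_num)
  have hc1 : ∀ i, Continuous fun x => fderiv ℝ v x (b i) := fun i =>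
    (hv2.continuous_fderiv two_ne_zero).clm_apply continuous_const
  have hc2 : ∀ i j, Continuous fun x => fderiv ℝ (fun y => fderiv ℝ v y (b i)) x (b j) :=
    fun i j => continuous_fderiv_fderiv_apply hv2 (b i) (b j)
  have hηcont : Continuous η := hηs.continuous
  have h0 : ∀ x ∉ tsupport η, η x = 0 := fun x hx => image_eq_zero_of_notMem_tsupport hx
  have hballS : ball x₀ (σ / 2) ⊆ closedBall x₀ σ :=
    ball_subset_closedBall.trans (closedBall_subset_closedBall (by linarith))
  refine ⟨?_, ?_, ?_⟩
  · -- first-order energy on the half ball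
    have hint : Integrable fun x => η x ^ 2 * ∑ i, (fderiv ℝ v x (b i)) ^ 2 :=
      integrable_of_continuous_of_tsupport hηc (by fun_prop) fun x hx => by simp [h0 x hx]
    calc ∫ x in ball x₀ (σ / 2), ∑ i, (fderiv ℝ u x (b i)) ^ 2
        = ∫ x in ball x₀ (σ / 2), η x ^ 2 * ∑ i, (fderiv ℝ v x (b i)) ^ 2 := by
          refine setIntegral_congr_fun measurableSet_ball fun x hx => ?_
          rw [hη1 x (ball_subset_closedBall hx), one_pow, one_mul]
          exact Finset.sum_congr rfl fun i _ => by rw [hD1 x (hballS hx)]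
      _ ≤ ∫ x, η x ^ 2 * ∑ i, (fderiv ℝ v x (b i)) ^ 2 :=
          setIntegral_le_integral hint (Eventually.of_forall fun x =>
            mul_nonneg (sq_nonneg _) (Finset.sum_nonneg fun i _ => sq_nonneg _))
      _ ≤ _ := h1
  · -- second-order energy on the half ball
    have hint : Integrable fun x =>
        η x ^ 4 * ∑ i, ∑ j, (fderiv ℝ (fun y => fderiv ℝ v y (b i)) x (b j)) ^ 2 :=
      integrable_of_continuous_of_tsupport hηc (by fun_prop) fun x hx => by simp [h0 x hx]
    calc ∫ x in ball x₀ (σ / 2), ∑ i, ∑ j, (fderiv ℝ (fun y => fderiv ℝ u y (b i)) x (b j)) ^ 2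
        = ∫ x in ball x₀ (σ / 2),
            η x ^ 4 * ∑ i, ∑ j, (fderiv ℝ (fun y => fderiv ℝ v y (b i)) x (b j)) ^ 2 := by
          refine setIntegral_congr_fun measurableSet_ball fun x hx => ?_
          rw [hη1 x (ball_subset_closedBall hx), one_pow, one_mul]
          exact Finset.sum_congr rfl fun i _ => Finset.sum_congr rfl fun j _ => by
            rw [hD2 x (hballS hx)]
      _ ≤ ∫ x, η x ^ 4 * ∑ i, ∑ j, (fderiv ℝ (fun y => fderiv ℝ v y (b i)) x (b j)) ^ 2 :=
          setIntegral_le_integral hint (Eventually.of_forall fun x =>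
            mul_nonneg (by positivity)
              (Finset.sum_nonneg fun i _ => Finset.sum_nonneg fun j _ => sq_nonneg _))
      _ ≤ _ := h2
  · -- the cut-off product
    refine ⟨fun y => η y ^ 2 * v y, (hη3.pow 2).mul hv, ?_, ?_, fun x hx => ?_, h3⟩
    · exact HasCompactSupport.intro hηc fun x hx => by simp [h0 x hx]
    · intro x hx
      refine hηS ?_
      by_contra hx'
      have hev : (fun y => η y ^ 2 * v y) =ᶠ[𝓝 x] fun _ => 0 := by
        filter_upwards [notMem_tsupport_iff_eventuallyEq.1 hx'] with z hz
        rw [hz, Pi.zero_apply]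
        ring
      exact (notMem_tsupport_iff_eventuallyEq.2 hev) hx
    · show η x ^ 2 * v x = u x
      rw [hη1 x hx, one_pow, one_mul, hveq x (closedBall_subset_closedBall (by linarith) hx)]

end Cutoff

end Literature.Analysis.PDE
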